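import Literature.MathematicalPhysics.QuantumFieldTheory.Balaban1983to89.B9Thm34GKernelFinal
import Literature.MathematicalPhysics.QuantumFieldTheory.Balaban1983to89.B9Thm34GUniform

/-!
# `Balaban1983to89.B9Thm34GKernelUniform` — [Balaban1985BackgroundPropagators] THEOREM 3.4 p. 400, THE `G(U′U)`-CLAUSE WITH ALL FOUR
# (3.42) ENTRIES IN THE PRINTED KERNEL FORM `B(Lʲη)^{2,1,1,0}(L^{j′}η)^{−d}e^{−(δ₀/10)d}` AND THE CONSTANTS CHOSEN BEFORE THE LATTICE —
# FILES 24/25 (`B9Thm34GKernel.thm34_G_kernelEntriesAll`, `B9Thm34GKernelFinal.exists_threshold_pOne`, `thm34_G_kernel_final`) re-quantified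
# `∃ a₁ ∃ B ∀ (T_η, k, {Ω_j}, U, letters)` (FILE 47 of the Sect. B programme of cell `lit-balaban`, seat r06 gen 20)

statement-level skeleton of published theorems with citation tags; proofs where landed; nothing here is a claim about the Yang–Mills mass gap

CITATION HEADER (lean-in-tree rule).  B9 = T. Bałaban, *Propagators for lattice gauge theories in a background field*, Commun. Math. Phys.
**99** (1985) 389–434 [Balaban1985BackgroundPropagators] (held `paper:balaban1985-cmp99-background-propagators`; journal page = PDF page + 388):
Theorem 3.4 p. 400 [PDF 12] L7–10 «There exists a positive constant a₁ such that the operators G′(U), (Q′(U)G′²(U)Q′*(U))⁻¹, R(U), G(U) extend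
to configurations U′U for α₁ ≦ a₁ as analytic functions of A. The extended operators satisfy all the inequalities of Theorems 3.1–3.3
correspondingly»; Theorem 3.1 p. 397 [PDF 9] «There exist positive constants M₁, δ₀, a₀, B₀ dependent on d and L only» and (3.42) «for
x ∈ Δ(y), y ∈ Λ_j, supp λ ⊂ Δ(y′)» (the printed KERNEL shape `B6RandomWalkKernel.HasKernelBound`); Theorem 3.3 p. 399 [PDF 11] «Under the
assumptions of Theorem 3.1, and with the constants described there»; p. 399 L1–3 «Let us stress that the constants in the formulations of
both theorems do not depend on the sequence {Ω_j}, j = 0, 1, …, k, if the conditions (2.1), (2.2) are satisfied»; p. 402 [PDF 14] L23 «We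
assume that Theorem 3.1 is valid for the operator G′(U)»; p. 403 [PDF 15] L5–7 «of course with different constants, although changes are
small. We define new constants in such a way that the statements of Theorem 3.1 hold for extended operators»; p. 407 [PDF 19]
(3.84)–(3.86) and «This way we get all these inequalities for the operator G(U′U), the local ones follow from the bound (3.85) and Lemma
2.1 [4]»; (3.76)–(3.77) pp. 405–406; Thm 3.2 (3.48) p. 398; (3.15)/(3.19)/(3.21)/(3.24)/(3.25) pp. 393–394; (3.57)/(3.59) pp. 401–402;
(3.35)/(3.37) p. 396.  [4] = [Balaban1984PropagatorsII] Lemma 2.1 p. 234 [PDF 12] («For the numbers α, 0 < α < 1, c₁(α) = 12c₀(½α), and RM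
satisfying (2.59)» — (2.60)–(2.61), lattice-free constants), (2.51)–(2.55) p. 232, (2.66) p. 234.  [B11] = [Balaban1985Variational] (135)
p. 298.  Rows B9.Thm3.4 × B9.Thm3.3 × B9.Thm3.2 × B9.Eq3.85 × B9.Eq3.76 (cells only; no row head changes).

WHY THIS FILE (B9-CLOSURE §3 item 4 / §5 item 2 (M); FILE 24 HONEST SCOPE (iii) «the constants `B`, `Λ` are existentially packaged AFTER the
lattice … the STATEMENT does not display this uniformity»).  FILES 45/46 re-quantified the three operator clauses of the Sect. B step in
block-majorant / (3.48) form; this file does the same for the `G(U′U)`-clause IN THE PRINTED KERNEL FORM of Theorem 3.3's (3.42) — the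
shape FILE 26 §3 / FILE 28 use for `G` — including the (3.77) threshold for the concrete `P₁(A)`.  As in FILES 45/46 the only change of
hypothesis is the p. 398 / [4] Lemma 2.1 scale transfer in its printed uniform form (ONE function `Λ(·) ≧ 1` for every lattice of the
family); every other hypothesis and every conclusion is carried verbatim, the lattice binder list moving behind `∃ a₁ ∃ B (∃ Λ / ∃ K)`.

WHAT IS PROVED (0 `def`, 0 sorry, 0 new named facts; standard axioms).
* §1 **`thm34_G_kernelEntriesAll_uniform`** — FILE 24 `thm34_G_kernelEntriesAll` (FILE 20's conclusions + GIVEN (3.77) for the concrete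
  `P₁(A)`: the four kernel bounds `|(X·G(U′U)·Y)(x,x′)| ≦ (B₀ + B·θ·Λ·c₁)·[(Lʲη)², Lʲη, Lʲη, 1]·e^{−(δ₀/10)d}·v(y′)⁻¹`) with
  `∃ a₁ > 0 ∃ B ≧ 0 ∃ Λ ≧ 1` BEFORE `∀ (lattice, …, Theorem 3.3's kernel members hGk hDGk hGDk hDGDk for G(U))`; `a₁`, `B` from FILE 46
  `thm34_G_clause_uniform`, `Λ = Λ(1/100)`.
* §2 **`exists_threshold_pOne_uniform`** — FILE 25 `exists_threshold_pOne` ((3.77) for the concrete `P₁(A)` with the printed quantifiers: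
  `∃ a₁ > 0 ∃ K ≧ 0 ∀ α₁ ≦ a₁ ∀ A … ∃ C⁻¹(U′U)` two-sided inverse with `P₁(A) ≺ Kα₁(Lʲη)⁻²e^{−(δ₀/5)d}`) with `a₁`, `K` BEFORE the lattice
  (the four threshold functions and the bound `K` of `κ₃₇₇(…)(α₁)` by `exists_bound_of_continuousAt` are lattice-free).
* §3 **`thm34_G_kernel_uniform`** — FILE 25 `thm34_G_kernel_final` (THE `G`-CLAUSE OF THEOREM 3.4, FINAL FORM: `∃ a₁ > 0 ∃ B ≧ 0 ∀ α₁ ≦ a₁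
  ∀ A …`: `C⁻¹(U′U)`, `G(U′U)` two-sided inverses; every left/right (3.42)-entry of Theorem 3.3 transfers in block-majorant form at
  `(B, δ₀/10)`; ALL FOUR entries in the printed kernel form `|(X·G(U′U)·Y)(x,x′)| ≦ B·P_{X,Y}(y)·e^{−(δ₀/10)d}·v(y′)⁻¹`, ONE constant `B`)
  with `a₁`, `B` BEFORE the lattice: §1 and §2 are invoked before the lattice is introduced, the two `C⁻¹(U′U)` identified inside
  (`left_inv_eq_right_inv`) exactly as in FILE 25.

PROOF.  Scripted re-ordering of the accepted texts of FILES 24/25 (as FILE 46 from FILE 20): scale-transfer constants `Λ := Λ(1/100)`,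
`Λ_ρ₁ := Λ(33/10000)`, `c₄ := Λ(1/10)` and the continuity-at-0 thresholds/bounds fixed first; per-lattice scale transfers rewritten along
`Λf _ = Λ`; calls of per-lattice theorems replaced by calls of their uniform twins BEFORE the lattice `intro`, their `∀`-clauses applied to
the lattice data afterwards (`replace Hmain := Hmain T U blk …`).

HONEST SCOPE / NOT CLAIMED.  As FILES 24/25: Theorems 3.1–3.3 FOR `U` are inputs (block-majorant AND kernel members); (3.37) blockwise; the
(3.15)/(3.19)/(3.57)/(3.59)/(3.80)–(3.81) letters are hypotheses of printed shape; Hölder/L² not covered; uniformity displayed = in the lattice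
data `(S, T, 𝔅, blk)`, the background, operators, letters and the kernel weights `v, c` AT FIXED input constants, `κ`, `(𝔸, b)` and `Λ(·)`;
the `R(U)`-clause (FILE 27), the capstones FILES 28/31 and FILES 29/30/32/33 keep the per-lattice shape (same recipe); rates/exponents one
admissible choice («of course with different constants», p. 403); analyticity = finite-lattice algebra; no row head changes.

RELATED IN THE TREE, NOT DUPLICATED (searched 2026-08-23: `lean search 'kernelEntriesAll_uniform|threshold_pOne_uniform|G_kernel_uniform' --decl`
= ∅): FILES 24/25 (per-lattice), FILE 46 `B9Thm34GUniform.thm34_G_clause_uniform`, FILE 25's `exists_cinv_pOne_concrete` /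
`exists_bound_of_continuousAt`, `B9Ineq385Kernel`/`B9Ineq385KernelConcrete` kernel steps USED BY NAME; no existing module modified.
-/

noncomputable section

namespace Literature.MathematicalPhysics.QuantumFieldTheory.Balaban1983to89.B9Thm34GKernelUniform

open NormedSpace Complex
open Literature.MathematicalPhysics.QuantumFieldTheory.Balaban1983to89

/-! ## §1  FILE 24's `thm34_G_kernelEntriesAll` with `a₁`, `B`, `Λ` chosen before the lattice -/

section KernelU

open Literature.MathematicalPhysics.QuantumFieldTheory.Balaban1983to89.B6RandomWalk (HasMajorant hasMajorant_mono Triangle254 Ineq261)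
open Literature.MathematicalPhysics.QuantumFieldTheory.Balaban1983to89.B6RandomWalkHom (HasMajorantHom)
open Literature.MathematicalPhysics.QuantumFieldTheory.Balaban1983to89.B6RandomWalkKernel (ker HasKernelBound hasKernelBound_mono)
open Literature.MathematicalPhysics.QuantumFieldTheory.Balaban1983to89.B9Thm34Ext (toB6)
open Literature.MathematicalPhysics.QuantumFieldTheory.Balaban1983to89.B9Ineq347 (ScaleTransfer)
open Literature.MathematicalPhysics.QuantumFieldTheory.Balaban1983to89.B9Eq386Neumann (pTwo deltaA vTotal vThree eq384_sub)
open Literature.MathematicalPhysics.QuantumFieldTheory.Balaban1983to89.B9Ineq385VG (kappa383 kappa383_nonneg kappa385 kappa385_nonneg ineq383_op)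
open Literature.MathematicalPhysics.QuantumFieldTheory.Balaban1983to89.B9Eq39Adjoint
open Literature.MathematicalPhysics.QuantumFieldTheory.Balaban1983to89.B9Eq369Small (Through)
open Literature.MathematicalPhysics.QuantumFieldTheory.Balaban1983to89.B9Eq372Locality (stBonds)
open Literature.MathematicalPhysics.QuantumFieldTheory.Balaban1983to89.B9Eq352DivForm (tauF tauB)
open Literature.MathematicalPhysics.QuantumFieldTheory.Balaban1983to89.B9Eq352DivFormLetters
open Literature.MathematicalPhysics.QuantumFieldTheory.Balaban1983to89.B9Eq352GradLetters (diffLetter)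
open Literature.MathematicalPhysics.QuantumFieldTheory.Balaban1983to89.B9Eq371GradLetters (bT bU)
open Literature.MathematicalPhysics.QuantumFieldTheory.Balaban1983to89.B9Eq372RemLetters (lapDDLetter V₁Op V₂Op conj_lapDDLetter_prodCfg)
open Literature.MathematicalPhysics.QuantumFieldTheory.Balaban1983to89.B9Eq382V3Letters (dPrimeLetter V₃Op conj_V₃Op_eq_vThree)
open Literature.MathematicalPhysics.QuantumFieldTheory.Balaban1983to89.B9Eq376POneLetters (conjHom gradLin divLin eq376_concrete)
open Literature.MathematicalPhysics.QuantumFieldTheory.Balaban1983to89.B9Ineq385V3Concrete (cV385 cV385_nonneg)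
open Literature.MathematicalPhysics.QuantumFieldTheory.Balaban1983to89.B9Eq360Vprime (gPrimeExtEnd)
open Literature.MathematicalPhysics.QuantumFieldTheory.Balaban1983to89.B9Eq360VprimeLetters (vPrimeConc)
open Literature.MathematicalPhysics.QuantumFieldTheory.Balaban1983to89.B6RandomWalkSection (secExt secRes secConj)
open Literature.MathematicalPhysics.QuantumFieldTheory.Balaban1983to89.B9Thm34GFinal (thm34_G_clause_final)
open Literature.MathematicalPhysics.QuantumFieldTheory.Balaban1983to89.B9Ineq385Kernel (hasKernelBound_rate_mono gExt_kernelEntry_of_386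
  gExt_kernelEntry1_of_386)
open Literature.MathematicalPhysics.QuantumFieldTheory.Balaban1983to89.B9Ineq385KernelConcrete (eq386_resolvent_of_inverses ineq385_kernel_concreteV₃)
open Literature.MathematicalPhysics.QuantumFieldTheory.Balaban1983to89.B9Thm34GUniform (thm34_G_clause_uniform)

variable {𝔸 : Type*} [NormedRing 𝔸] [NormedAlgebra ℂ 𝔸] [CompleteSpace 𝔸] {ι : Type} [Fintype ι]
variable (b : Module.Basis ι ℝ 𝔸) (κ : Type) [Fintype κ] [LinearOrder κ]

set_option maxHeartbeats 1600000 in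
/-- **THEOREM 3.4, `G`-CLAUSE, ALL FOUR ENTRIES OF (3.42) FOR `G(U′U)` IN THE PRINTED KERNEL FORM, CONSTANTS BEFORE THE LATTICE** — FILE 24
`B9Thm34GKernel.thm34_G_kernelEntriesAll` verbatim in hypotheses and conclusions, re-quantified `∃ a₁ > 0 ∃ B ≧ 0 ∃ Λ ≧ 1 ∀ (lattice, background,
letters, Theorems 3.1–3.3 for U, kernel inputs) ∀ α₁ ≦ a₁ ∀ A …` («the constants … do not depend on the sequence {Ω_j}», p. 399): FILE 46's
`thm34_G_clause_uniform` supplies `a₁`, `B` before the lattice; `Λ = Λ(1/100)` of the given scale-transfer function; the kernel step («the local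
ones follow from the bound (3.85) and Lemma 2.1 [4]», p. 407) is FILE 24's, verbatim.
[cite: Balaban1985BackgroundPropagators, Thm 3.4 p.400 + p.399 + (3.42) p.397 + (3.84)–(3.86) p.407 + (3.76)–(3.77) pp.405–406 + Thm 3.3 p.399; Balaban1984PropagatorsII, (2.51)–(2.55) p.232 + Lemma 2.1 p.234] -/
theorem thm34_G_kernelEntriesAll_uniform [DecidableEq ι] (d : ℕ)
    (δ₀ B₀ κQ BG B₁ cF Cq a₀ C₀ d₀ M₂ κQb cFb abar : ℝ) (Λf : ℝ → ℝ)
    (hB₀ : 0 ≤ B₀) (hκQ : 0 < κQ) (hBG : 0 < BG) (hB₁ : 0 < B₁) (hcF : 0 < cF) (hCq : 0 ≤ Cq) (ha₀ : 0 ≤ a₀) (hC₀ : 0 ≤ C₀)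
    (hM₂ : 0 ≤ M₂) (hδ₀ : 0 < δ₀) (hκQb : 0 ≤ κQb) (hcFb : 0 ≤ cFb) (habar : 0 ≤ abar) (hΛf : ∀ α : ℝ, 0 < α → 1 ≤ Λf α)
    (hrepr : ∀ (v : 𝔸) (i : ι), |b.repr v i| ≤ M₂ * ‖v‖) :
    ∃ a₁ : ℝ, 0 < a₁ ∧ ∃ B : ℝ, 0 ≤ B ∧ ∃ Λ : ℝ, 1 ≤ Λ ∧
    ∀ {S : Type} [Fintype S] [DecidableEq S] (T : κ → Equiv.Perm S) (U : κ → S → 𝔸ˣ)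
      {g : B9.Geometry} [Fintype g.Site] [DecidableEq g.Site] [Nonempty g.Site] {Rr : ℝ} {H : Prop} (blk : S → g.Site)
      (kQ : g.Site → S → 𝔸 →L[ℝ] 𝔸) (sQ : S → 𝔸 →L[ℝ] 𝔸) (cfun w : g.Site → ℝ)
    -- the multiscale geometry 𝔅 (p. 393, [4] (2.1)–(2.4)) and its axioms
    (hdnn : ∀ a a' : g.Site, 0 ≤ g.dist a a') (htri : Triangle254 (toB6 g Rr H)) (hrefl : ∀ y : g.Site, g.dist y y = 0)
    (hsym : ∀ y y' : g.Site, g.dist y y' = g.dist y' y) (hlen : ∀ y : g.Site, 0 < g.len y) (hlenη : ∀ y : g.Site, g.eta ≤ g.len y)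
    (hη : 0 < g.eta) (hL : 1 ≤ g.L)
    -- [4] Lemma 2.1 (2.61) at the rate `δ₀`, «for every 0 < α < 1»
    (h261 : ∀ α : ℝ, 0 < α → α < 1 → Ineq261 d (toB6 g Rr H) δ₀ α)
    -- p. 398: «Using Lemma 2.1 in [4] we may replace the factor (Lʲη)^α by (Lʲη)^β(L^{j′}η)^γ with β + γ = α» — for every exponent, one
    -- constant `Λ(α) ≧ 1` for the six weights `(Lʲη)^{1,2,−1,−2,−4}` (natural and real powers)
      (hST : ∀ α : ℝ, 0 < α → ScaleTransfer g δ₀ α (Λf α) (fun a => g.len a) ∧ ScaleTransfer g δ₀ α (Λf α) (fun a => g.len a ^ 2) ∧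
        ScaleTransfer g δ₀ α (Λf α) (fun a => (g.len a)⁻¹) ∧ ScaleTransfer g δ₀ α (Λf α) (fun a => (g.len a ^ 2)⁻¹) ∧
        ScaleTransfer g δ₀ α (Λf α) (fun a => (g.len a ^ 4)⁻¹) ∧ ScaleTransfer g δ₀ α (Λf α) (fun y => g.len y ^ (-(4 : ℝ))))
    -- real coordinates of `𝔸`, commuting translations, unitary-type background
    (hT : ∀ (μ ν : κ) (x : S), T μ (T ν x) = T ν (T μ x))
    (hU1 : ∀ m z, ‖((U m z : 𝔸ˣ) : 𝔸)‖ ≤ 1 ∧ ‖(((U m z)⁻¹ : 𝔸ˣ) : 𝔸)‖ ≤ 1)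
    -- (3.35) on the plaquettes through each bond, at that bond's block scale; stencil geometry at range `d₀`
    (h35 : ∀ μ x m n y, Through T μ x m n y → ‖(plaqU T U m n y : 𝔸) - 1‖ ≤ C₀ * ((g.L ^ g.scale (blk x))⁻¹) ^ 2)
    (hd₀B : ∀ μ x, g.dist (blk x) (blk ((T μ).symm x)) ≤ d₀) (hd₀F : ∀ μ x, g.dist (blk x) (blk (T μ x)) ≤ d₀)
    (hd₀FB : ∀ μ ν x, g.dist (blk x) (blk ((T ν).symm (T μ x))) ≤ d₀)
    (hd₀st : ∀ μ x (q : κ × S), q ∈ stBonds T μ x → g.dist (blk x) (blk q.2) ≤ d₀)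
    (hd₀loc : ∀ μ x (q : κ × S), q ∈ B9Eq375Locality.locBondsA' T μ x → g.dist (blk x) (blk q.2) ≤ d₀)
    (hd₀0 : ∀ y : g.Site, g.dist y y ≤ d₀)
    -- the `A`-independent data of the concrete `V′(A)` of (3.60): (3.19) kernels/multipliers and the `a`-weights of (3.24)
    (hw : ∀ y, 0 ≤ w y) (hcard : ∀ y, ((B9Eq360Vprime.block blk y).card : ℝ) * w y ≤ 1)
    (hkQ : ∀ y x, blk x = y → ‖kQ y x‖ ≤ w y) (hsQ : ∀ x, ‖sQ x‖ ≤ 1) (hcfun : ∀ y, |cfun y| ≤ a₀ * (g.len y ^ 2)⁻¹)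
    -- THEOREM 3.1 for `G′(U)`: (3.42)₁,₂,₃ at the rate `δ₀`
    {Gp : Module.End ℝ (S × ι → ℝ)}
    (h342_1 : HasMajorant (g := toB6 g Rr H) (fun p : S × ι => blk p.1) Gp
      (fun a a' => BG * g.len a ^ 2 * Real.exp (-(δ₀ * g.dist a a'))))
    (h342_2 : ∀ k : κ ⊕ κ, HasMajorant (g := toB6 g Rr H) (fun p : S × ι => blk p.1)
      (conj b (diffLetter T U ((g.eta : ℂ)⁻¹) k) * Gp) (fun a a' => BG * g.len a * Real.exp (-(δ₀ * g.dist a a'))))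
    (h342_3 : ∀ k : κ ⊕ κ, HasMajorant (g := toB6 g Rr H) (fun p : S × ι => blk p.1)
      (Gp * conj b (diffLetter T U ((g.eta : ℂ)⁻¹) k)) (fun a a' => BG * g.len a * Real.exp (-(δ₀ * g.dist a a'))))
    -- the (3.19) letters `Q′(U)`, `Q′*(U)` in their own typing with block-local two-space majorants, a section of the block map (FILE 17)
    (rep : g.Site → S × ι) (hrep : ∀ y : g.Site, blk (rep y).1 = y)
    {Qc : (S × ι → ℝ) →ₗ[ℝ] (g.Site → ℝ)} {Qcs : (g.Site → ℝ) →ₗ[ℝ] (S × ι → ℝ)} {Linv : Module.End ℝ (g.Site → ℝ)}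
    (hQc : HasMajorantHom (g := toB6 g Rr H) (fun p : S × ι => blk p.1) (fun y : g.Site => y) Qc
      (fun a a' : g.Site => κQ * (if a = a' then (1 : ℝ) else 0)))
    (hQcs : HasMajorantHom (g := toB6 g Rr H) (fun y : g.Site => y) (fun p : S × ι => blk p.1) Qcs
      (fun a a' : g.Site => κQ * (if a = a' then (1 : ℝ) else 0)))
    -- THEOREM 3.2 for `U`: (3.21) `C⁻¹ = (Q′G′²Q′*)⁻¹` exists (`hLinv`) with the KERNEL bound (3.48) at the rate `δ₀`
    (hLinv : (Qc ∘ₗ (Gp * Gp) ∘ₗ Qcs) * Linv = 1)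
    (h348 : ∀ y y' : g.Site, |B9Thm34Inv.ker (B9Thm34Inv.vol g d) Linv y y'| ≤
      B₁ * g.len y ^ (-(4 : ℝ)) * g.len y' ^ (-(d : ℝ)) * Real.exp (-(δ₀ * g.dist y y')))
    -- the (3.15) bond letters `Q(U)`, `Q*(U)` and the weight letter `a` of (3.24)/(3.26), with their majorants
    {G Qs Q a : Module.End ℝ ((κ × S) × ι → ℝ)}
    (hQb : HasMajorant (g := toB6 g Rr H) (fun q : (κ × S) × ι => blk q.1.2) Q (fun a a' => κQb * Real.exp (-(δ₀ * g.dist a a'))))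
    (hQsb : HasMajorant (g := toB6 g Rr H) (fun q : (κ × S) × ι => blk q.1.2) Qs (fun a a' => κQb * Real.exp (-(δ₀ * g.dist a a'))))
    (ha324 : HasMajorant (g := toB6 g Rr H) (fun q : (κ × S) × ι => blk q.1.2) a
      (fun a a' : g.Site => if a = a' then abar * (g.len a ^ 2)⁻¹ else 0))
    -- THEOREM 3.3 for `G(U)`: two-sided inverse of the concrete `Δ_a(U)` and its (3.42)-entries at the rate `δ₀`
    (hΔG : deltaA (conj b (lapDDLetter T ((g.eta : ℂ)⁻¹) U)) (conj b (dPrimeLetter T U g.eta))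
      (conjHom b (gradLin T ((g.eta : ℂ)⁻¹) U) ∘ₗ (1 - (Gp ∘ₗ Qcs ∘ₗ Linv ∘ₗ Qc ∘ₗ Gp)) ∘ₗ conjHom b (divLin T ((g.eta : ℂ)⁻¹) U)) Qs a Q * G = 1)
    (hGΔ : G * deltaA (conj b (lapDDLetter T ((g.eta : ℂ)⁻¹) U)) (conj b (dPrimeLetter T U g.eta))
      (conjHom b (gradLin T ((g.eta : ℂ)⁻¹) U) ∘ₗ (1 - (Gp ∘ₗ Qcs ∘ₗ Linv ∘ₗ Qc ∘ₗ Gp)) ∘ₗ conjHom b (divLin T ((g.eta : ℂ)⁻¹) U)) Qs a Q = 1)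
    (hG : HasMajorant (g := toB6 g Rr H) (fun q : (κ × S) × ι => blk q.1.2) G
      (fun a a' => B₀ * g.len a ^ 2 * Real.exp (-(δ₀ * g.dist a a'))))
    (hDG : ∀ k : κ ⊕ κ, HasMajorant (g := toB6 g Rr H) (fun q : (κ × S) × ι => blk q.1.2)
      (conj b (diffLetter (bT T) (bU U) ((g.eta : ℂ)⁻¹) k) * G) (fun a a' => B₀ * g.len a * Real.exp (-(δ₀ * g.dist a a'))))
    (hGD : ∀ k : κ ⊕ κ, HasMajorant (g := toB6 g Rr H) (fun q : (κ × S) × ι => blk q.1.2)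
      (G * conj b (diffLetter (bT T) (bU U) ((g.eta : ℂ)⁻¹) k)) (fun a a' => B₀ * g.len a * Real.exp (-(δ₀ * g.dist a a'))))
    -- NEW (kernel form): Theorem 3.3's (3.42)₁,₂,₃,₄ for `G(U)` as PRINTED KERNEL BOUNDS (pairing weight `c = η^d`, volume weight `v(y′) = (L^j′ η)^d`)
    {v : g.Site → ℝ} (hv : ∀ y, 0 < v y) {c : ℝ} (hc : 0 < c)
    (hGk : HasKernelBound (g := toB6 g Rr H) (fun q : (κ × S) × ι => blk q.1.2) v c G
      (fun a a' => B₀ * g.len a ^ 2 * Real.exp (-(δ₀ * g.dist a a'))))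
    (hDGk : ∀ k : κ ⊕ κ, HasKernelBound (g := toB6 g Rr H) (fun q : (κ × S) × ι => blk q.1.2) v c
      (conj b (diffLetter (bT T) (bU U) ((g.eta : ℂ)⁻¹) k) * G) (fun a a' => B₀ * g.len a * Real.exp (-(δ₀ * g.dist a a'))))
    (hGDk : ∀ l : κ ⊕ κ, HasKernelBound (g := toB6 g Rr H) (fun q : (κ × S) × ι => blk q.1.2) v c
      (G * conj b (diffLetter (bT T) (bU U) ((g.eta : ℂ)⁻¹) l)) (fun a a' => B₀ * g.len a * Real.exp (-(δ₀ * g.dist a a'))))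
    (hDGDk : ∀ k l : κ ⊕ κ, HasKernelBound (g := toB6 g Rr H) (fun q : (κ × S) × ι => blk q.1.2) v c
      (conj b (diffLetter (bT T) (bU U) ((g.eta : ℂ)⁻¹) k) * G * conj b (diffLetter (bT T) (bU U) ((g.eta : ℂ)⁻¹) l)) (fun a a' => B₀ * Real.exp (-(δ₀ * g.dist a a')))),
    ∀ (α₁ : ℝ), 0 ≤ α₁ → α₁ ≤ a₁ →
    -- the exponent field `A` in the domain (3.37), read blockwise in the shapes of FILES 1–19, and the `A`-dependent (3.59) data `kF`, `sF`
    ∀ (A : κ → S → 𝔸) (kF : g.Site → S → 𝔸 →L[ℝ] 𝔸) (sF : S → 𝔸 →L[ℝ] 𝔸),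
      (∀ y x, blk x = y → ‖kF y x‖ ≤ Cq * α₁ * w y) → (∀ x, ‖sF x‖ ≤ Cq * α₁) →
      (∀ ν k x, ‖((g.eta : ℂ)⁻¹) • covDstar T U ν (A k) x‖ ≤ α₁ * (g.len (blk x) ^ 2)⁻¹) →
      (∀ μ ν x, ‖((g.eta : ℂ)⁻¹) • covD T U μ (A ν) x‖ ≤ α₁ * (g.len (blk x) ^ 2)⁻¹) →
      (∀ μ ν x, ‖((g.eta : ℂ)⁻¹) • covDstar T U ν (A ν) (T μ x)‖ ≤ α₁ * (g.len (blk x) ^ 2)⁻¹) →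
      (∀ μ x, ‖((g.eta : ℂ)⁻¹) • covDstar T U μ (tauB T U μ (A μ)) x‖ ≤ α₁ * (g.len (blk x) ^ 2)⁻¹) →
      (∀ μ ν k x, ‖((g.eta : ℂ)⁻¹) • covD T U μ (A k) ((T ν).symm x)‖ ≤ α₁ * (g.len (blk x) ^ 2)⁻¹) →
      (∀ k x, ‖A k x‖ ≤ α₁ * (g.len (blk x))⁻¹) → (∀ ν k x, ‖tauB T U ν (A k) x‖ ≤ α₁ * (g.len (blk x))⁻¹) →
      (∀ μ k x, ‖tauF T U μ (A k) x‖ ≤ α₁ * (g.len (blk x))⁻¹) →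
      (∀ k μ ν x, ‖A k ((T ν).symm (T μ x))‖ ≤ α₁ * (g.len (blk x))⁻¹) →
      (∀ μ x m z, (m, z) ∈ stBonds T μ x → ‖A m z‖ ≤ α₁ * (g.len (blk x))⁻¹) →
      (∀ μ x m z, (m, z) ∈ B9Eq375Locality.locBondsA T μ x → ‖A m z‖ ≤ α₁ * (g.len (blk x))⁻¹) →
      (∀ μ x m n y, Through T μ x m n y →
        ‖covD T U m (A n) y‖ ≤ g.eta * (α₁ * ((g.len (blk x))⁻¹) ^ 2) ∧ ‖covD T U n (A m) y‖ ≤ g.eta * (α₁ * ((g.len (blk x))⁻¹) ^ 2)) →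
    -- the (3.57)/(3.59) letters `F′₂(A)`, `F′₂*(A)` (block-local, size `c_F α₁`)
    ∀ {Qc' Fc : (S × ι → ℝ) →ₗ[ℝ] (g.Site → ℝ)} {Qcs' Fcs : (g.Site → ℝ) →ₗ[ℝ] (S × ι → ℝ)},
      Qc' = Qc + Fc → Qcs' = Qcs + Fcs →
      HasMajorantHom (g := toB6 g Rr H) (fun p : S × ι => blk p.1) (fun y : g.Site => y) Fc
        (fun a a' : g.Site => cF * α₁ * (if a = a' then (1 : ℝ) else 0)) →
      HasMajorantHom (g := toB6 g Rr H) (fun y : g.Site => y) (fun p : S × ι => blk p.1) Fcs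
        (fun a a' : g.Site => cF * α₁ * (if a = a' then (1 : ℝ) else 0)) →
    -- the (3.80)–(3.81) letters `F₂(A)`, `F₂*(A)` («|F₂(A)|, |F₂*(A)| ≦ O(1)α₁»), `P₂(A)` of (3.82)
    ∀ {P₂ Qs' Q' F₂ F₂s : Module.End ℝ ((κ × S) × ι → ℝ)},
      Q' = Q + F₂ → Qs' = Qs + F₂s → P₂ = pTwo Qs Q F₂ F₂s a →
      HasMajorant (g := toB6 g Rr H) (fun q : (κ × S) × ι => blk q.1.2) F₂ (fun a a' => cFb * α₁ * Real.exp (-(δ₀ * g.dist a a'))) →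
      HasMajorant (g := toB6 g Rr H) (fun q : (κ × S) × ι => blk q.1.2) F₂s (fun a a' => cFb * α₁ * Real.exp (-(δ₀ * g.dist a a'))) →
    ∃ (Tinv : Module.End ℝ (g.Site → ℝ)) (GExt : Module.End ℝ ((κ × S) × ι → ℝ)),
      Tinv * (Qc' ∘ₗ ((gPrimeExtEnd Gp (conj b (vPrimeConc T U g.eta A blk kQ kF sQ sF cfun) * Gp)) * (gPrimeExtEnd Gp (conj b (vPrimeConc T U g.eta A blk kQ kF sQ sF cfun) * Gp))) ∘ₗ Qcs') = 1 ∧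
      (Qc' ∘ₗ ((gPrimeExtEnd Gp (conj b (vPrimeConc T U g.eta A blk kQ kF sQ sF cfun) * Gp)) * (gPrimeExtEnd Gp (conj b (vPrimeConc T U g.eta A blk kQ kF sQ sF cfun) * Gp))) ∘ₗ Qcs') * Tinv = 1 ∧
      deltaA (conj b (lapDDLetter T ((g.eta : ℂ)⁻¹) (prodCfg U g.eta A)))
          (conj b (dPrimeLetter T (prodCfg U g.eta A) g.eta))
          (conjHom b (gradLin T ((g.eta : ℂ)⁻¹) (prodCfg U g.eta A)) ∘ₗ (1 - ((Gp ∘ₗ Qcs ∘ₗ Linv ∘ₗ Qc ∘ₗ Gp) + (B9Eq360Vprime.pPrime Gp (gPrimeExtEnd Gp (conj b (vPrimeConc T U g.eta A blk kQ kF sQ sF cfun) * Gp)) (Qcs ∘ₗ secRes rep) (Qcs' ∘ₗ secRes rep) (secConj rep Linv) (secConj rep Tinv) (secExt rep ∘ₗ Qc) (secExt rep ∘ₗ Qc'))))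
            ∘ₗ conjHom b (divLin T ((g.eta : ℂ)⁻¹) (prodCfg U g.eta A))) Qs' a Q' * GExt = 1 ∧
      GExt *
      deltaA (conj b (lapDDLetter T ((g.eta : ℂ)⁻¹) (prodCfg U g.eta A)))
          (conj b (dPrimeLetter T (prodCfg U g.eta A) g.eta))
          (conjHom b (gradLin T ((g.eta : ℂ)⁻¹) (prodCfg U g.eta A)) ∘ₗ (1 - ((Gp ∘ₗ Qcs ∘ₗ Linv ∘ₗ Qc ∘ₗ Gp) + (B9Eq360Vprime.pPrime Gp (gPrimeExtEnd Gp (conj b (vPrimeConc T U g.eta A blk kQ kF sQ sF cfun) * Gp)) (Qcs ∘ₗ secRes rep) (Qcs' ∘ₗ secRes rep) (secConj rep Linv) (secConj rep Tinv) (secExt rep ∘ₗ Qc) (secExt rep ∘ₗ Qc'))))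
            ∘ₗ conjHom b (divLin T ((g.eta : ℂ)⁻¹) (prodCfg U g.eta A))) Qs' a Q' = 1 ∧
      (∀ (X : Module.End ℝ ((κ × S) × ι → ℝ)) (P : g.Site → ℝ), (∀ y, 0 ≤ P y) →
        HasMajorant (g := toB6 g Rr H) (fun q : (κ × S) × ι => blk q.1.2) (X * G)
          (fun a a' => B₀ * P a * Real.exp (-(δ₀ * g.dist a a'))) →
        HasMajorant (g := toB6 g Rr H) (fun q : (κ × S) × ι => blk q.1.2) (X * GExt)
          (fun a a' => B * P a * Real.exp (-(δ₀ / 6 * g.dist a a')))) ∧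
      (∀ Y : Module.End ℝ ((κ × S) × ι → ℝ),
        HasMajorant (g := toB6 g Rr H) (fun q : (κ × S) × ι => blk q.1.2) (G * Y)
          (fun a a' => B₀ * g.len a * Real.exp (-(δ₀ * g.dist a a'))) →
        HasMajorant (g := toB6 g Rr H) (fun q : (κ × S) × ι => blk q.1.2) (GExt * Y)
          (fun a a' => B * g.len a * Real.exp (-(δ₀ / 6 * g.dist a a')))) ∧
      -- NEW: ALL FOUR ENTRIES OF (3.42) FOR `G(U′U)` IN THE PRINTED KERNEL FORM, given (3.77) for the concrete `P₁(A)` of (3.76) at the rate `δ₀/5`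
      (∀ κ₁ : ℝ, 0 ≤ κ₁ →
        HasMajorant (g := toB6 g Rr H) (fun q : (κ × S) × ι => blk q.1.2)
          ((conjHom b (gradLin T ((g.eta : ℂ)⁻¹) (prodCfg U g.eta A)) - conjHom b (gradLin T ((g.eta : ℂ)⁻¹) U)) ∘ₗ (Gp ∘ₗ Qcs ∘ₗ Linv ∘ₗ Qc ∘ₗ Gp) ∘ₗ conjHom b (divLin T ((g.eta : ℂ)⁻¹) U)
            + conjHom b (gradLin T ((g.eta : ℂ)⁻¹) U) ∘ₗ (Gp ∘ₗ Qcs ∘ₗ Linv ∘ₗ Qc ∘ₗ Gp) ∘ₗ (conjHom b (divLin T ((g.eta : ℂ)⁻¹) (prodCfg U g.eta A)) - conjHom b (divLin T ((g.eta : ℂ)⁻¹) U))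
            + (conjHom b (gradLin T ((g.eta : ℂ)⁻¹) (prodCfg U g.eta A)) - conjHom b (gradLin T ((g.eta : ℂ)⁻¹) U)) ∘ₗ (Gp ∘ₗ Qcs ∘ₗ Linv ∘ₗ Qc ∘ₗ Gp) ∘ₗ (conjHom b (divLin T ((g.eta : ℂ)⁻¹) (prodCfg U g.eta A)) - conjHom b (divLin T ((g.eta : ℂ)⁻¹) U))
            + conjHom b (gradLin T ((g.eta : ℂ)⁻¹) (prodCfg U g.eta A)) ∘ₗ (B9Eq360Vprime.pPrime Gp (gPrimeExtEnd Gp (conj b (vPrimeConc T U g.eta A blk kQ kF sQ sF cfun) * Gp)) (Qcs ∘ₗ secRes rep) (Qcs' ∘ₗ secRes rep) (secConj rep Linv) (secConj rep Tinv) (secExt rep ∘ₗ Qc) (secExt rep ∘ₗ Qc')) ∘ₗ conjHom b (divLin T ((g.eta : ℂ)⁻¹) (prodCfg U g.eta A)))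
          (fun a a' => κ₁ * α₁ * (g.len a ^ 2)⁻¹ * Real.exp (-(1 / 5 * δ₀ * g.dist a a'))) →
        HasKernelBound (g := toB6 g Rr H) (fun q : (κ × S) × ι => blk q.1.2) v c GExt
          (fun a a' => (B₀ + B * (kappa385 B₀ (cV385 (Fintype.card κ) α₁ C₀ (M₂ * (∑ i, ‖b i‖) * Real.exp (1 / 5 * δ₀ * d₀))) κ₁
            (kappa383 κQb cFb abar Λ (B6.c1 d δ₀ (1 / 100)) α₁) Λ (B6.c1 d δ₀ (1 / 100)) * α₁) * Λ * B6.c1 d δ₀ (1 / 100)) * g.len a ^ 2 * Real.exp (-(1 / 10 * δ₀ * g.dist a a'))) ∧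
        (∀ k : κ ⊕ κ, HasKernelBound (g := toB6 g Rr H) (fun q : (κ × S) × ι => blk q.1.2) v c
          (conj b (diffLetter (bT T) (bU U) ((g.eta : ℂ)⁻¹) k) * GExt)
          (fun a a' => (B₀ + B * (kappa385 B₀ (cV385 (Fintype.card κ) α₁ C₀ (M₂ * (∑ i, ‖b i‖) * Real.exp (1 / 5 * δ₀ * d₀))) κ₁
            (kappa383 κQb cFb abar Λ (B6.c1 d δ₀ (1 / 100)) α₁) Λ (B6.c1 d δ₀ (1 / 100)) * α₁) * Λ * B6.c1 d δ₀ (1 / 100)) * g.len a * Real.exp (-(1 / 10 * δ₀ * g.dist a a')))) ∧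
        (∀ l : κ ⊕ κ, HasKernelBound (g := toB6 g Rr H) (fun q : (κ × S) × ι => blk q.1.2) v c
          (GExt * conj b (diffLetter (bT T) (bU U) ((g.eta : ℂ)⁻¹) l))
          (fun a a' => (B₀ + B * (kappa385 B₀ (cV385 (Fintype.card κ) α₁ C₀ (M₂ * (∑ i, ‖b i‖) * Real.exp (1 / 5 * δ₀ * d₀))) κ₁
            (kappa383 κQb cFb abar Λ (B6.c1 d δ₀ (1 / 100)) α₁) Λ (B6.c1 d δ₀ (1 / 100)) * α₁) * Λ * B6.c1 d δ₀ (1 / 100)) * g.len a * Real.exp (-(1 / 10 * δ₀ * g.dist a a')))) ∧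
        (∀ k l : κ ⊕ κ, HasKernelBound (g := toB6 g Rr H) (fun q : (κ × S) × ι => blk q.1.2) v c
          (conj b (diffLetter (bT T) (bU U) ((g.eta : ℂ)⁻¹) k) * GExt * conj b (diffLetter (bT T) (bU U) ((g.eta : ℂ)⁻¹) l))
          (fun a a' => (B₀ + B * (kappa385 B₀ (cV385 (Fintype.card κ) α₁ C₀ (M₂ * (∑ i, ‖b i‖) * Real.exp (1 / 5 * δ₀ * d₀))) κ₁
            (kappa383 κQb cFb abar Λ (B6.c1 d δ₀ (1 / 100)) α₁) Λ (B6.c1 d δ₀ (1 / 100)) * α₁) * Λ * B6.c1 d δ₀ (1 / 100)) * Real.exp (-(1 / 10 * δ₀ * g.dist a a'))))) := by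
  classical
  obtain ⟨a₁, ha₁, B, hB, Hmain⟩ := thm34_G_clause_uniform b κ d δ₀ B₀ κQ BG B₁ cF Cq a₀ C₀ d₀ M₂ κQb cFb abar Λf hB₀ hκQ hBG hB₁ hcF hCq
    ha₀ hC₀ hM₂ hδ₀ hκQb hcFb habar hΛf hrepr
  -- the p. 398 scale-transfer constant at exponent 1/100, READ FROM THE GIVEN FUNCTION `Λ(·)` (lattice-free)
  obtain ⟨Λ, hΛ, hΛeq⟩ : ∃ Λ : ℝ, 1 ≤ Λ ∧ Λf (1 / 100) = Λ := ⟨_, hΛf _ (by norm_num), rfl⟩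
  refine ⟨min a₁ (1 / 4), lt_min ha₁ (by norm_num), B, hB, Λ, hΛ, ?_⟩
  -- NOW the lattice, the background, the letters, Theorems 3.1–3.3 for `U` and the kernel inputs; then `α₁`, `A` and the `A`-letters
  intro S _ _ T U g _ _ _ Rr H blk kQ sQ cfun w hdnn htri hrefl hsym hlen hlenη hη hL h261 hST hT hU1 h35 hd₀B hd₀F hd₀FB hd₀st hd₀loc hd₀0
    hw hcard hkQ hsQ hcfun Gp h342_1 h342_2 h342_3 rep hrep Qc Qcs Linv hQc hQcs hLinv h348 G Qs Q a hQb hQsb ha324 hΔG hGΔ hG hDG hGD v hv c hc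
    hGk hDGk hGDk hDGDk α₁ hα₁0 hα₁1 A kF sF hkF hsF h337B h337F h337B' h337Bτ h337FB hA hAτB hAτF hAFB hAst hAloc hdAst Qc' Fc Qcs' Fcs h357 h357s hFc hFcs P₂ Qs' Q' F₂ F₂s h380 h380s hP₂def hF₂ hF₂s
  replace Hmain := Hmain T U blk kQ sQ cfun w hdnn htri hrefl hsym hlen hlenη hη hL h261 hST hT hU1 h35 hd₀B hd₀F hd₀FB hd₀st hd₀loc hd₀0 hw
    hcard hkQ hsQ hcfun h342_1 h342_2 h342_3 rep hrep hQc hQcs hLinv h348 hQb hQsb ha324 hΔG hGΔ hG hDG hGD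
  obtain ⟨hT1, hT2, hT1i, hT2i, -, -⟩ := hST (1 / 100) (by norm_num)
  rw [hΛeq] at hT1 hT2 hT1i hT2i
  have hα₁a : α₁ ≤ a₁ := hα₁1.trans (min_le_left _ _)
  have hα₁q : α₁ ≤ 1 / 4 := hα₁1.trans (min_le_right _ _)
  obtain ⟨Tinv, GExt, e1, e2, e3, e4, hLeft, hRight⟩ := Hmain α₁ hα₁0 hα₁a A kF sF hkF hsF h337B h337F h337B' h337Bτ h337FB hA hAτB
    hAτF hAFB hAst hAloc hdAst h357 h357s hFc hFcs h380 h380s hP₂def hF₂ hF₂s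
  refine ⟨Tinv, GExt, e1, e2, e3, e4, hLeft, hRight, ?_⟩
  intro κ₁ hκ₁ hP₁
  -- constants and their signs
  have hΛ0 : 0 ≤ Λ := zero_le_one.trans hΛ
  have hSb : 0 ≤ ∑ i, ‖b i‖ := Finset.sum_nonneg fun i _ => norm_nonneg _
  have hc₁ : 0 ≤ B6.c1 d δ₀ (1 / 100) := B6RandomWalk.c1_nonneg d δ₀ (1 / 100)
  have h261β : Ineq261 d (toB6 g Rr H) δ₀ (1 / 100) := h261 (1 / 100) (by norm_num) (by norm_num)
  have hκ₂0 : 0 ≤ kappa383 κQb cFb abar Λ (B6.c1 d δ₀ (1 / 100)) α₁ := kappa383_nonneg hκQb hcFb habar hΛ0 hc₁ hα₁0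
  have hw1 : ∀ a : g.Site, 0 ≤ g.len a := fun a => (hlen a).le
  have hw2 : ∀ a : g.Site, 0 ≤ g.len a ^ 2 := fun a => sq_nonneg _
  have hw1i : ∀ a : g.Site, 0 ≤ (g.len a)⁻¹ := fun a => inv_nonneg.mpr (hlen a).le
  have hδ5 : 1 / 5 * δ₀ ≤ δ₀ := by linarith only [hδ₀]
  -- `η·α₁(Lʲη)⁻¹ ≦ 1/4` from `α₁ ≦ 1/4` and `η ≦ Lʲη`
  have hsmall : ∀ y : g.Site, g.eta * (α₁ * (g.len y)⁻¹) ≤ 1 / 4 := fun y => by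
    have hq : g.eta * (g.len y)⁻¹ ≤ 1 := by
      rw [← div_eq_mul_inv]; exact (div_le_one (hlen y)).mpr (hlenη y)
    calc g.eta * (α₁ * (g.len y)⁻¹) = α₁ * (g.eta * (g.len y)⁻¹) := by ring
      _ ≤ α₁ * 1 := mul_le_mul_of_nonneg_left hq hα₁0
      _ ≤ 1 / 4 := by linarith only [hα₁q]
  -- `P₂`'s (3.83) from the (3.15)/(3.80)–(3.81) letters (`B9Ineq385VG.ineq383_op`), at the rate `δ₀/5`
  have hP₂ : HasMajorant (g := toB6 g Rr H) (fun q : (κ × S) × ι => blk q.1.2) P₂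
      (fun a a' => kappa383 κQb cFb abar Λ (B6.c1 d δ₀ (1 / 100)) α₁ * α₁ * (g.len a ^ 2)⁻¹ *
        Real.exp (-(1 / 5 * δ₀ * g.dist a a'))) := by
    rw [hP₂def]
    exact ineq383_op (R := Rr) (H := H) (fun q : (κ × S) × ι => blk q.1.2) d δ₀ δ₀ (1 / 100) (1 / 100) (1 / 5 * δ₀) Λ κQb cFb
      abar α₁ hκQb hcFb habar hα₁0 hΛ0 (by linarith only [hδ₀]) (by norm_num) (by norm_num) hδ₀.le (by linarith only [hδ₀]) hdnn htri
      h261β hT2i hQb hQsb hF₂ hF₂s ha324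
  -- (3.84) for the concrete operators and the resolvent form of (3.86)
  have h371 := conj_lapDDLetter_prodCfg (b := b) (T := T) (U := U) hη.ne' A
  have h376 := eq376_concrete T U b hη.ne' A (Gp ∘ₗ Qcs ∘ₗ Linv ∘ₗ Qc ∘ₗ Gp)
    (B9Eq360Vprime.pPrime Gp (gPrimeExtEnd Gp (conj b (vPrimeConc T U g.eta A blk kQ kF sQ sF cfun) * Gp)) (Qcs ∘ₗ secRes rep) (Qcs' ∘ₗ secRes rep) (secConj rep Linv) (secConj rep Tinv) (secExt rep ∘ₗ Qc) (secExt rep ∘ₗ Qc'))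
  have h384 := eq384_sub _ _ (conj b (dPrimeLetter T U g.eta)) (conj b (dPrimeLetter T (prodCfg U g.eta A) g.eta)) _ _ Qs Qs' Q Q' a
    (conj b (V₁Op T U g.eta A)) (conj b (V₂Op T U g.eta A)) _ F₂ F₂s h371 h376 h380 h380s
  rw [← conj_V₃Op_eq_vThree, ← hP₂def] at h384
  have h386 := eq386_resolvent_of_inverses hΔG e4 h384
  have hθ : 0 ≤ (kappa385 B₀ (cV385 (Fintype.card κ) α₁ C₀ (M₂ * (∑ i, ‖b i‖) * Real.exp (1 / 5 * δ₀ * d₀))) κ₁ (kappa383 κQb cFb abar Λ (B6.c1 d δ₀ (1 / 100)) α₁) Λ (B6.c1 d δ₀ (1 / 100)) * α₁) :=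
    mul_nonneg (kappa385_nonneg hB₀ (cV385_nonneg (Fintype.card κ) hα₁0 hC₀ (by positivity)) hκ₁ hκ₂0 hΛ0 hc₁) hα₁0
  -- scale transfers for the weights `(Lʲη)²·(Lʲη)⁻¹ = Lʲη`, `Lʲη·(Lʲη)⁻¹ = 1`, and the constant weight
  have hT2' : ScaleTransfer g δ₀ (1 / 100) Λ (fun a => g.len a ^ 2 * (g.len a)⁻¹) := by
    have e : (fun a : g.Site => g.len a ^ 2 * (g.len a)⁻¹) = fun a => g.len a := by
      funext a; have ha : g.len a ≠ 0 := (hlen a).ne'; field_simp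
    rw [e]; exact hT1
  have hSTc : ∀ C : ℝ, 1 ≤ C → ScaleTransfer g δ₀ (1 / 100) C (fun _ : g.Site => (1 : ℝ)) := fun C hC y y' => by
    rw [mul_one, mul_one]
    exact (Real.exp_le_one_iff.mpr (by nlinarith [hdnn y y', hδ₀])).trans hC
  have hT1' : ScaleTransfer g δ₀ (1 / 100) Λ (fun a => g.len a * (g.len a)⁻¹) := by
    have e : (fun a : g.Site => g.len a * (g.len a)⁻¹) = fun _ => (1 : ℝ) := by
      funext a; exact mul_inv_cancel₀ (hlen a).ne'
    rw [e]; exact hSTc Λ hΛ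
  -- (3.85) with the kernel bound on the right letter `Tr = G(U)` (weight `(Lʲη)²`)
  have hGk5 := hasKernelBound_rate_mono (R := Rr) (H := H) (fun q : (κ × S) × ι => blk q.1.2) hv c B₀ (fun a => g.len a ^ 2) hB₀ hw2 hδ5 hdnn hGk
  have hDGk5 : ∀ k : κ ⊕ κ, HasKernelBound (g := toB6 g Rr H) (fun q : (κ × S) × ι => blk q.1.2) v c (conj b (diffLetter (bT T) (bU U) ((g.eta : ℂ)⁻¹) k) * G)
      (fun a a' => B₀ * (g.len a ^ 2 * (g.len a)⁻¹) * Real.exp (-(1 / 5 * δ₀ * g.dist a a'))) := by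
    intro k
    have h := hasKernelBound_rate_mono (R := Rr) (H := H) (fun q : (κ × S) × ι => blk q.1.2) hv c B₀ (fun a => g.len a) hB₀ hw1 hδ5 hdnn (hDGk k)
    refine hasKernelBound_mono (g := toB6 g Rr H) _ hv h fun a a' => le_of_eq ?_
    have ha : g.len a ≠ 0 := (hlen a).ne'
    field_simp
  have h385k := ineq385_kernel_concreteV₃ (Rr := Rr) (H := H) b T U blk d δ₀ (1 / 5 * δ₀) (1 / 100) (1 / 100) (1 / 10 * δ₀) Λ B₀ κ₁
    (kappa383 κQb cFb abar Λ (B6.c1 d δ₀ (1 / 100)) α₁) α₁ C₀ d₀ M₂ (fun a => g.len a ^ 2) hB₀ hκ₁ hκ₂0 hα₁0 hC₀ hΛ0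
    (by linarith only [hδ₀]) (by norm_num) (by norm_num) hδ₀.le (by linarith only [hδ₀]) hM₂ (by linarith only [hδ₀]) hw2 hdnn htri hlen
    h261β hT2 hT2' hrepr hη hL A hsmall hU1 h337B h337F h337B' hA hAτB hAτF hAst hAloc hdAst h35 hd₀B hd₀F hd₀FB hd₀st hd₀loc hd₀0
    hv hc hP₁ hP₂ hGk5 hDGk5
  have h385k' : HasKernelBound (g := toB6 g Rr H) (fun q : (κ × S) × ι => blk q.1.2) v c
      (vTotal (conj b (V₃Op T U g.eta A)) ((conjHom b (gradLin T ((g.eta : ℂ)⁻¹) (prodCfg U g.eta A)) - conjHom b (gradLin T ((g.eta : ℂ)⁻¹) U)) ∘ₗ (Gp ∘ₗ Qcs ∘ₗ Linv ∘ₗ Qc ∘ₗ Gp) ∘ₗ conjHom b (divLin T ((g.eta : ℂ)⁻¹) U) + conjHom b (gradLin T ((g.eta : ℂ)⁻¹) U) ∘ₗ (Gp ∘ₗ Qcs ∘ₗ Linv ∘ₗ Qc ∘ₗ Gp) ∘ₗ (conjHom b (divLin T ((g.eta : ℂ)⁻¹) (prodCfg U g.eta A)) - conjHom b (divLin T ((g.eta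 : ℂ)⁻¹) U)) + (conjHom b (gradLin T ((g.eta : ℂ)⁻¹) (prodCfg U g.eta A)) - conjHom b (gradLin T ((g.eta : ℂ)⁻¹) U)) ∘ₗ (Gp ∘ₗ Qcs ∘ₗ Linv ∘ₗ Qc ∘ₗ Gp) ∘ₗ (conjHom b (divLin T ((g.eta : ℂ)⁻¹) (prodCfg U g.eta A)) - conjHom b (divLin T ((g.eta : ℂ)⁻¹) U)) + conjHom b (gradLin T ((g.eta : ℂ)⁻¹) (prodCfg U g.eta A)) ∘ₗ (B9Eq360Vprime.pPrime Gp (gPrimeExtEnd Gp (conj b (vPrimeConc T U g.eta A blk kQ kF sQ sF cfun) * Gp)) (Qcs ∘ₗ secRes rep) (Qcs' ∘ₗ secRes rep) (secConj rep Linv) (secConj rep Tinv) (secExt rep ∘ₗ Qc) (secExt rep ∘ₗ Qc')) ∘ₗ conjHom b (divLin T ((g.eta : ℂ)⁻¹) (prodCfg U g.eta A))) P₂ * G * 1)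
      (fun a a' => (kappa385 B₀ (cV385 (Fintype.card κ) α₁ C₀ (M₂ * (∑ i, ‖b i‖) * Real.exp (1 / 5 * δ₀ * d₀))) κ₁ (kappa383 κQb cFb abar Λ (B6.c1 d δ₀ (1 / 100)) α₁) Λ (B6.c1 d δ₀ (1 / 100)) * α₁) * 1 * Real.exp (-(1 / 10 * δ₀ * g.dist a a'))) := by
    rw [mul_one]
    refine hasKernelBound_mono (g := toB6 g Rr H) _ hv h385k fun a a' => le_of_eq ?_
    have ha : g.len a ≠ 0 := (hlen a).ne'
    field_simp
  -- (3.85) with the kernel bound on the right letter `Tr = G(U)∇*_l` (weight `Lʲη`)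
  have h385kR : ∀ l : κ ⊕ κ, HasKernelBound (g := toB6 g Rr H) (fun q : (κ × S) × ι => blk q.1.2) v c
      (vTotal (conj b (V₃Op T U g.eta A)) ((conjHom b (gradLin T ((g.eta : ℂ)⁻¹) (prodCfg U g.eta A)) - conjHom b (gradLin T ((g.eta : ℂ)⁻¹) U)) ∘ₗ (Gp ∘ₗ Qcs ∘ₗ Linv ∘ₗ Qc ∘ₗ Gp) ∘ₗ conjHom b (divLin T ((g.eta : ℂ)⁻¹) U) + conjHom b (gradLin T ((g.eta : ℂ)⁻¹) U) ∘ₗ (Gp ∘ₗ Qcs ∘ₗ Linv ∘ₗ Qc ∘ₗ Gp) ∘ₗ (conjHom b (divLin T ((g.eta : ℂ)⁻¹) (prodCfg U g.eta A)) - conjHom b (divLin T ((g.eta : ℂ)⁻¹) U)) + (conjHom b (gradLin T ((g.eta : ℂ)⁻¹) (prodCfg U g.eta A)) - conjHom b (gradLin T ((g.eta : ℂ)⁻¹) U)) ∘ₗ (Gp ∘ₗ Qcs ∘ₗ Linv ∘ₗ Qc ∘ₗ Gp) ∘ₗ (conjHom b (divLin T ((g.eta : ℂ)⁻¹) (prodCfg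 U g.eta A)) - conjHom b (divLin T ((g.eta : ℂ)⁻¹) U)) + conjHom b (gradLin T ((g.eta : ℂ)⁻¹) (prodCfg U g.eta A)) ∘ₗ (B9Eq360Vprime.pPrime Gp (gPrimeExtEnd Gp (conj b (vPrimeConc T U g.eta A blk kQ kF sQ sF cfun) * Gp)) (Qcs ∘ₗ secRes rep) (Qcs' ∘ₗ secRes rep) (secConj rep Linv) (secConj rep Tinv) (secExt rep ∘ₗ Qc) (secExt rep ∘ₗ Qc')) ∘ₗ conjHom b (divLin T ((g.eta : ℂ)⁻¹) (prodCfg U g.eta A))) P₂ * G * conj b (diffLetter (bT T) (bU U) ((g.eta : ℂ)⁻¹) l))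
      (fun a a' => (kappa385 B₀ (cV385 (Fintype.card κ) α₁ C₀ (M₂ * (∑ i, ‖b i‖) * Real.exp (1 / 5 * δ₀ * d₀))) κ₁ (kappa383 κQb cFb abar Λ (B6.c1 d δ₀ (1 / 100)) α₁) Λ (B6.c1 d δ₀ (1 / 100)) * α₁) * (g.len a)⁻¹ * Real.exp (-(1 / 10 * δ₀ * g.dist a a'))) := by
    intro l
    have hTr := hasKernelBound_rate_mono (R := Rr) (H := H) (fun q : (κ × S) × ι => blk q.1.2) hv c B₀ (fun a => g.len a) hB₀ hw1 hδ5 hdnn (hGDk l)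
    have hDTr : ∀ k : κ ⊕ κ, HasKernelBound (g := toB6 g Rr H) (fun q : (κ × S) × ι => blk q.1.2) v c (conj b (diffLetter (bT T) (bU U) ((g.eta : ℂ)⁻¹) k) * (G * conj b (diffLetter (bT T) (bU U) ((g.eta : ℂ)⁻¹) l)))
        (fun a a' => B₀ * (g.len a * (g.len a)⁻¹) * Real.exp (-(1 / 5 * δ₀ * g.dist a a'))) := by
      intro k
      have h := hasKernelBound_rate_mono (R := Rr) (H := H) (fun q : (κ × S) × ι => blk q.1.2) hv c B₀ (fun _ => (1 : ℝ)) hB₀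
        (fun _ => zero_le_one) hδ5 hdnn
        (show HasKernelBound (g := toB6 g Rr H) (fun q : (κ × S) × ι => blk q.1.2) v c (conj b (diffLetter (bT T) (bU U) ((g.eta : ℂ)⁻¹) k) * (G * conj b (diffLetter (bT T) (bU U) ((g.eta : ℂ)⁻¹) l)))
          (fun a a' => B₀ * (1 : ℝ) * Real.exp (-(δ₀ * g.dist a a'))) by
          rw [← mul_assoc]; simpa only [mul_one] using hDGDk k l)
      refine hasKernelBound_mono (g := toB6 g Rr H) _ hv h fun a a' => le_of_eq ?_
      rw [mul_inv_cancel₀ (hlen a).ne']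
    have h := ineq385_kernel_concreteV₃ (Rr := Rr) (H := H) b T U blk d δ₀ (1 / 5 * δ₀) (1 / 100) (1 / 100) (1 / 10 * δ₀) Λ B₀ κ₁
      (kappa383 κQb cFb abar Λ (B6.c1 d δ₀ (1 / 100)) α₁) α₁ C₀ d₀ M₂ (fun a => g.len a) hB₀ hκ₁ hκ₂0 hα₁0 hC₀ hΛ0
      (by linarith only [hδ₀]) (by norm_num) (by norm_num) hδ₀.le (by linarith only [hδ₀]) hM₂ (by linarith only [hδ₀]) hw1 hdnn htri hlen
      h261β hT1 hT1' hrepr hη hL A hsmall hU1 h337B h337F h337B' hA hAτB hAτF hAst hAloc hdAst h35 hd₀B hd₀F hd₀FB hd₀st hd₀loc hd₀0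
      hv hc hP₁ hP₂ hTr hDTr
    rw [← mul_assoc] at h
    refine hasKernelBound_mono (g := toB6 g Rr H) _ hv h fun a a' => le_of_eq ?_
    have ha : g.len a ≠ 0 := (hlen a).ne'
    field_simp
  -- the majorants of `X·G(U′U)` from FILE 20's universal left clause
  have hGExt1 : HasMajorant (g := toB6 g Rr H) (fun q : (κ × S) × ι => blk q.1.2) (1 * GExt)
      (fun a a' => B * g.len a ^ 2 * Real.exp (-(δ₀ / 6 * g.dist a a'))) :=
    hLeft 1 (fun a => g.len a ^ 2) hw2 (by rw [one_mul]; exact hG)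
  have hGExtD : ∀ k : κ ⊕ κ, HasMajorant (g := toB6 g Rr H) (fun q : (κ × S) × ι => blk q.1.2) (conj b (diffLetter (bT T) (bU U) ((g.eta : ℂ)⁻¹) k) * GExt)
      (fun a a' => B * g.len a * Real.exp (-(δ₀ / 6 * g.dist a a'))) := fun k => hLeft _ (fun a => g.len a) hw1 (hDG k)
  -- the four entries
  have hr10 : 0 ≤ 1 / 10 * δ₀ := by linarith only [hδ₀]
  have hr6 : 1 / 10 * δ₀ + (1 / 100 + 1 / 100) * δ₀ ≤ δ₀ / 6 := by linarith only [hδ₀]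
  have hr1 : 1 / 10 * δ₀ ≤ δ₀ := by linarith only [hδ₀]
  refine ⟨?_, fun k => ?_, fun l => ?_, fun k l => ?_⟩
  · -- (1, 1)
    have h342' : HasKernelBound (g := toB6 g Rr H) (fun q : (κ × S) × ι => blk q.1.2) v c (1 * G * 1)
        (fun a a' => B₀ * (g.len a ^ 2 * 1) * Real.exp (-(δ₀ * g.dist a a'))) := by
      rw [one_mul, mul_one]; simpa only [mul_one] using hGk
    have h := gExt_kernelEntry_of_386 (R := Rr) (H := H) (fun q : (κ × S) × ι => blk q.1.2) d δ₀ (1 / 100) (1 / 100) (1 / 10 * δ₀) δ₀ (δ₀ / 6)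
      Λ B₀ B _ (fun a => g.len a ^ 2) (fun _ => 1) hB₀ hB hθ hw2 (fun _ => zero_le_one) hΛ0 hr10 hr6 hr1 hdnn htri (hSTc Λ hΛ) h261β hv hc
      h386 h342' hGExt1 h385k'
    rw [one_mul, mul_one] at h
    exact hasKernelBound_mono (g := toB6 g Rr H) _ hv h fun a a' => le_of_eq (by ring)
  · -- (∇_k, 1)
    have h342' : HasKernelBound (g := toB6 g Rr H) (fun q : (κ × S) × ι => blk q.1.2) v c (conj b (diffLetter (bT T) (bU U) ((g.eta : ℂ)⁻¹) k) * G * 1)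
        (fun a a' => B₀ * (g.len a * 1) * Real.exp (-(δ₀ * g.dist a a'))) := by
      rw [mul_one]; simpa only [mul_one] using hDGk k
    have h := gExt_kernelEntry_of_386 (R := Rr) (H := H) (fun q : (κ × S) × ι => blk q.1.2) d δ₀ (1 / 100) (1 / 100) (1 / 10 * δ₀) δ₀ (δ₀ / 6)
      Λ B₀ B _ (fun a => g.len a) (fun _ => 1) hB₀ hB hθ hw1 (fun _ => zero_le_one) hΛ0 hr10 hr6 hr1 hdnn htri (hSTc Λ hΛ) h261β hv hc
      h386 h342' (hGExtD k) h385k'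
    rw [mul_one] at h
    exact hasKernelBound_mono (g := toB6 g Rr H) _ hv h fun a a' => le_of_eq (by ring)
  · -- (1, ∇*_l)
    have h342' : HasKernelBound (g := toB6 g Rr H) (fun q : (κ × S) × ι => blk q.1.2) v c (1 * G * conj b (diffLetter (bT T) (bU U) ((g.eta : ℂ)⁻¹) l))
        (fun a a' => B₀ * (g.len a ^ 2 * (g.len a)⁻¹) * Real.exp (-(δ₀ * g.dist a a'))) := by
      rw [one_mul]
      refine hasKernelBound_mono (g := toB6 g Rr H) _ hv (hGDk l) fun a a' => le_of_eq ?_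
      have ha : g.len a ≠ 0 := (hlen a).ne'
      field_simp
    have h := gExt_kernelEntry_of_386 (R := Rr) (H := H) (fun q : (κ × S) × ι => blk q.1.2) d δ₀ (1 / 100) (1 / 100) (1 / 10 * δ₀) δ₀ (δ₀ / 6)
      Λ B₀ B _ (fun a => g.len a ^ 2) (fun a => (g.len a)⁻¹) hB₀ hB hθ hw2 hw1i hΛ0 hr10 hr6 hr1 hdnn htri hT1i h261β hv hc
      h386 h342' hGExt1 (h385kR l)
    rw [one_mul] at h
    refine hasKernelBound_mono (g := toB6 g Rr H) _ hv h fun a a' => le_of_eq ?_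
    have ha : g.len a ≠ 0 := (hlen a).ne'
    field_simp
  · -- (∇_k, ∇*_l)
    have h342' : HasKernelBound (g := toB6 g Rr H) (fun q : (κ × S) × ι => blk q.1.2) v c (conj b (diffLetter (bT T) (bU U) ((g.eta : ℂ)⁻¹) k) * G * conj b (diffLetter (bT T) (bU U) ((g.eta : ℂ)⁻¹) l))
        (fun a a' => B₀ * (g.len a * (g.len a)⁻¹) * Real.exp (-(δ₀ * g.dist a a'))) := by
      refine hasKernelBound_mono (g := toB6 g Rr H) _ hv (hDGDk k l) fun a a' => le_of_eq ?_
      rw [mul_inv_cancel₀ (hlen a).ne', mul_one]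
    have h := gExt_kernelEntry_of_386 (R := Rr) (H := H) (fun q : (κ × S) × ι => blk q.1.2) d δ₀ (1 / 100) (1 / 100) (1 / 10 * δ₀) δ₀ (δ₀ / 6)
      Λ B₀ B _ (fun a => g.len a) (fun a => (g.len a)⁻¹) hB₀ hB hθ hw1 hw1i hΛ0 hr10 hr6 hr1 hdnn htri hT1i h261β hv hc
      h386 h342' (hGExtD k) (h385kR l)
    refine hasKernelBound_mono (g := toB6 g Rr H) _ hv h fun a a' => le_of_eq ?_
    rw [mul_inv_cancel₀ (hlen a).ne', mul_one]

end KernelU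

/-! ## §2  FILE 25's `exists_threshold_pOne` with `a₁`, `K` chosen before the lattice -/

section POneU

open Literature.MathematicalPhysics.QuantumFieldTheory.Balaban1983to89.B6RandomWalk (HasMajorant hasMajorant_mono Triangle254 Ineq261)
open Literature.MathematicalPhysics.QuantumFieldTheory.Balaban1983to89.B6RandomWalkHom (HasMajorantHom hasMajorantHom_mono hasMajorantHom_iff)
open Literature.MathematicalPhysics.QuantumFieldTheory.Balaban1983to89.B6RandomWalkKernel (HasKernelBound hasKernelBound_mono)
open Literature.MathematicalPhysics.QuantumFieldTheory.Balaban1983to89.B9Thm34Ext (toB6)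
open Literature.MathematicalPhysics.QuantumFieldTheory.Balaban1983to89.B9Ineq347 (ScaleTransfer)
open Literature.MathematicalPhysics.QuantumFieldTheory.Balaban1983to89.B9Ineq366CPrime (hasMajorant_rate_mono cPrimeHom kappa366 kappa366_nonneg
  kappa366_pos)
open Literature.MathematicalPhysics.QuantumFieldTheory.Balaban1983to89.B9Eq386Neumann (pTwo deltaA)
open Literature.MathematicalPhysics.QuantumFieldTheory.Balaban1983to89.B9Ineq377POne (kappa377 kappa377_nonneg)
open Literature.MathematicalPhysics.QuantumFieldTheory.Balaban1983to89.B9Ineq385VG (kappa383 kappa383_nonneg kappa385 kappa385_nonneg)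
open Literature.MathematicalPhysics.QuantumFieldTheory.Balaban1983to89.B9Eq39Adjoint
open Literature.MathematicalPhysics.QuantumFieldTheory.Balaban1983to89.B9Eq369Small (Through)
open Literature.MathematicalPhysics.QuantumFieldTheory.Balaban1983to89.B9Eq372Locality (stBonds)
open Literature.MathematicalPhysics.QuantumFieldTheory.Balaban1983to89.B9Eq352DivForm (tauF tauB)
open Literature.MathematicalPhysics.QuantumFieldTheory.Balaban1983to89.B9Eq352DivFormLetters
open Literature.MathematicalPhysics.QuantumFieldTheory.Balaban1983to89.B9Eq352GradLetters (diffLetter)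
open Literature.MathematicalPhysics.QuantumFieldTheory.Balaban1983to89.B9Eq371GradLetters (bT bU)
open Literature.MathematicalPhysics.QuantumFieldTheory.Balaban1983to89.B9Eq372RemLetters (lapDDLetter)
open Literature.MathematicalPhysics.QuantumFieldTheory.Balaban1983to89.B9Eq382V3Letters (dPrimeLetter)
open Literature.MathematicalPhysics.QuantumFieldTheory.Balaban1983to89.B9Eq376POneLetters (conjHom gradLin divLin)
open Literature.MathematicalPhysics.QuantumFieldTheory.Balaban1983to89.B9Ineq385V3Concrete (cV385 cV385_nonneg)
open Literature.MathematicalPhysics.QuantumFieldTheory.Balaban1983to89.B9Ineq377POneConcrete (ineq377_concreteE)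
open Literature.MathematicalPhysics.QuantumFieldTheory.Balaban1983to89.B9Ineq349Hom (ineq349_hom)
open Literature.MathematicalPhysics.QuantumFieldTheory.Balaban1983to89.B9Ineq368PPrime (kappa349 kappa368)
open Literature.MathematicalPhysics.QuantumFieldTheory.Balaban1983to89.B9Ineq368PPrimeDs (kappa368Ds kappa368Ds_nonneg kappa368_nonneg kappa349_nonneg)
open Literature.MathematicalPhysics.QuantumFieldTheory.Balaban1983to89.B9Eq360Vprime (gPrimeExtEnd eq365_end_left eq365_end opNorm_lt_one_of_363_261)
open Literature.MathematicalPhysics.QuantumFieldTheory.Balaban1983to89.B9Eq360VprimeLetters (vPrimeConc cBConc cCConc)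
open Literature.MathematicalPhysics.QuantumFieldTheory.Balaban1983to89.B9Ineq363Vprime (cVConc cVConc_nonneg theta363 thetaL363 theta363_nonneg
  thetaL363_nonneg ineq363_op_vPrime)
open Literature.MathematicalPhysics.QuantumFieldTheory.Balaban1983to89.B9Ineq368Vprime (ineq368_op_conc ineq368_op_D_conc ineq368_op_Ds_conc
  ineq368_op_DDs_conc)
open Literature.MathematicalPhysics.QuantumFieldTheory.Balaban1983to89.B9Eq376DerivDict (hasMajorantHom_gradLin_comp hasMajorantHom_gradLin
  hasMajorantHom_comp_divLin hasMajorantHom_divLin hasMajorant_gradLin_comp_comp_divLin)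
open Literature.MathematicalPhysics.QuantumFieldTheory.Balaban1983to89.B6RandomWalkSection
open Literature.MathematicalPhysics.QuantumFieldTheory.Balaban1983to89.B9Ineq366Vprime (eq365b_hom hasMajorant_cPrimeHom_vPrime
  inverse_satisfies_thm32_vPrime)
open Literature.MathematicalPhysics.QuantumFieldTheory.Balaban1983to89.B9Thm34GFinal (ineq261_rescale scaleTransfer_rescale c1_pos_of_ineq261
  exists_threshold_of_continuousAt)
open Literature.MathematicalPhysics.QuantumFieldTheory.Balaban1983to89.B9Thm34GKernel (thm34_G_kernelEntriesAll)
/-! ## §1  (3.77) for the concrete `P₁(A)` as a theorem (site letters; coarse letters through a section) -/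
open Literature.MathematicalPhysics.QuantumFieldTheory.Balaban1983to89.B9Thm34GKernelFinal (exists_cinv_pOne_concrete exists_bound_of_continuousAt)
open Literature.MathematicalPhysics.QuantumFieldTheory.Balaban1983to89.B6RandomWalk (c1_nonneg)

variable {𝔸 : Type*} [NormedRing 𝔸] [NormedAlgebra ℂ 𝔸] [CompleteSpace 𝔸] {ι : Type} [Fintype ι]
variable (b : Module.Basis ι ℝ 𝔸) (κ : Type) [Fintype κ]

set_option maxHeartbeats 800000 in
/-- **(3.77) FOR THE CONCRETE `P₁(A)` WITH THE PRINTED QUANTIFIERS, THRESHOLD AND CONSTANT BEFORE THE LATTICE** — FILE 25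
`B9Thm34GKernelFinal.exists_threshold_pOne` verbatim in hypotheses and conclusion (p. 406 «Using Lemma 2.1 [4], we can estimate easily the above
expression and we get |(P₁(A)f)(b)| ≦ O(1)α₁(Lʲη)⁻²e^{−(1/2)δ₀d(y,y′)}|f| (3.77)»; p. 403 (3.65)–(3.67)), re-quantified `∃ a₁ > 0 ∃ K ≧ 0 ∀ (lattice,
background, (3.19)/(3.60) data, Theorem 3.1 (3.42)₁₋₃ for G′(U), (3.19) letters + section, Theorem 3.2 for U) ∀ α₁ ≦ a₁ ∀ A … ∀ (3.57)/(3.59) letters`: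
the four threshold functions of the `C⁻¹(U′U)`/`P′(A)`-chain and the bound `K` of the explicit (3.77) constant are lattice-free.
[cite: Balaban1985BackgroundPropagators, (3.76)–(3.77) pp.405–406 + (3.65)–(3.68) p.403 + Thm 3.2 (3.48) p.398 + Thm 3.1 (3.42) p.397 + (3.19)/(3.25) pp.393–394 + (3.57) p.401 + (3.59) p.402 + p.399; Balaban1984PropagatorsII, Lemma 2.1 p.234 + (2.51)–(2.55) p.232] -/
theorem exists_threshold_pOne_uniform [DecidableEq ι] (d : ℕ)
    (δ₀ κQ BG B₁ cF Cq a₀ d₀ M₂ : ℝ) (Λf : ℝ → ℝ)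
    (hκQ : 0 < κQ) (hBG : 0 < BG) (hB₁ : 0 < B₁) (hcF : 0 < cF) (hCq : 0 ≤ Cq) (ha₀ : 0 ≤ a₀) (hM₂ : 0 ≤ M₂) (hδ₀ : 0 < δ₀) (hΛf : ∀ α : ℝ, 0 < α → 1 ≤ Λf α)
    (hrepr : ∀ (v : 𝔸) (i : ι), |b.repr v i| ≤ M₂ * ‖v‖) :
    ∃ a₁ : ℝ, 0 < a₁ ∧ ∃ K : ℝ, 0 ≤ K ∧
    ∀ {S : Type} [Fintype S] [DecidableEq S] (T : κ → Equiv.Perm S) (U : κ → S → 𝔸ˣ)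
      {g : B9.Geometry} [Fintype g.Site] [DecidableEq g.Site] [Nonempty g.Site] {Rr : ℝ} {H : Prop} (blk : S → g.Site)
      (kQ : g.Site → S → 𝔸 →L[ℝ] 𝔸) (sQ : S → 𝔸 →L[ℝ] 𝔸) (cfun w : g.Site → ℝ)
    -- the multiscale geometry 𝔅 and its axioms
    (hdnn : ∀ a a' : g.Site, 0 ≤ g.dist a a') (htri : Triangle254 (toB6 g Rr H)) (hrefl : ∀ y : g.Site, g.dist y y = 0)
    (hsym : ∀ y y' : g.Site, g.dist y y' = g.dist y' y) (hlen : ∀ y : g.Site, 0 < g.len y) (hlenη : ∀ y : g.Site, g.eta ≤ g.len y)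
    (hη : 0 < g.eta)
    -- [4] Lemma 2.1 (2.61) at the rate `δ₀`, «for every 0 < α < 1», and the p. 398 scale transfer for every exponent
    (h261 : ∀ α : ℝ, 0 < α → α < 1 → Ineq261 d (toB6 g Rr H) δ₀ α)
      (hST : ∀ α : ℝ, 0 < α → ScaleTransfer g δ₀ α (Λf α) (fun a => g.len a) ∧ ScaleTransfer g δ₀ α (Λf α) (fun a => g.len a ^ 2) ∧
        ScaleTransfer g δ₀ α (Λf α) (fun a => (g.len a)⁻¹) ∧ ScaleTransfer g δ₀ α (Λf α) (fun a => (g.len a ^ 2)⁻¹) ∧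
        ScaleTransfer g δ₀ α (Λf α) (fun a => (g.len a ^ 4)⁻¹) ∧ ScaleTransfer g δ₀ α (Λf α) (fun y => g.len y ^ (-(4 : ℝ))))
    (hU1 : ∀ m z, ‖((U m z : 𝔸ˣ) : 𝔸)‖ ≤ 1 ∧ ‖(((U m z)⁻¹ : 𝔸ˣ) : 𝔸)‖ ≤ 1)
    (hd₀B : ∀ μ x, g.dist (blk x) (blk ((T μ).symm x)) ≤ d₀) (hd₀F : ∀ μ x, g.dist (blk x) (blk (T μ x)) ≤ d₀)
    (hd₀0 : ∀ y : g.Site, g.dist y y ≤ d₀)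
    -- the `A`-independent data of the concrete `V′(A)` of (3.60)
    (hw : ∀ y, 0 ≤ w y) (hcard : ∀ y, ((B9Eq360Vprime.block blk y).card : ℝ) * w y ≤ 1)
    (hkQ : ∀ y x, blk x = y → ‖kQ y x‖ ≤ w y) (hsQ : ∀ x, ‖sQ x‖ ≤ 1) (hcfun : ∀ y, |cfun y| ≤ a₀ * (g.len y ^ 2)⁻¹)
    -- THEOREM 3.1 for `G′(U)`: (3.42)₁,₂,₃ at the rate `δ₀`
    {Gp : Module.End ℝ (S × ι → ℝ)}
    (h342_1 : HasMajorant (g := toB6 g Rr H) (fun p : S × ι => blk p.1) Gp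
      (fun a a' => BG * g.len a ^ 2 * Real.exp (-(δ₀ * g.dist a a'))))
    (h342_2 : ∀ k : κ ⊕ κ, HasMajorant (g := toB6 g Rr H) (fun p : S × ι => blk p.1)
      (conj b (diffLetter T U ((g.eta : ℂ)⁻¹) k) * Gp) (fun a a' => BG * g.len a * Real.exp (-(δ₀ * g.dist a a'))))
    (h342_3 : ∀ k : κ ⊕ κ, HasMajorant (g := toB6 g Rr H) (fun p : S × ι => blk p.1)
      (Gp * conj b (diffLetter T U ((g.eta : ℂ)⁻¹) k)) (fun a a' => BG * g.len a * Real.exp (-(δ₀ * g.dist a a'))))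
    -- the (3.19) letters `Q′(U)`, `Q′*(U)` in their own typing with block-local two-space majorants, a section of the block map (FILE 17)
    (rep : g.Site → S × ι) (hrep : ∀ y : g.Site, blk (rep y).1 = y)
    {Qc : (S × ι → ℝ) →ₗ[ℝ] (g.Site → ℝ)} {Qcs : (g.Site → ℝ) →ₗ[ℝ] (S × ι → ℝ)} {Linv : Module.End ℝ (g.Site → ℝ)}
    (hQc : HasMajorantHom (g := toB6 g Rr H) (fun p : S × ι => blk p.1) (fun y : g.Site => y) Qc
      (fun a a' : g.Site => κQ * (if a = a' then (1 : ℝ) else 0)))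
    (hQcs : HasMajorantHom (g := toB6 g Rr H) (fun y : g.Site => y) (fun p : S × ι => blk p.1) Qcs
      (fun a a' : g.Site => κQ * (if a = a' then (1 : ℝ) else 0)))
    -- THEOREM 3.2 for `U`: (3.21) `C⁻¹ = (Q′G′²Q′*)⁻¹` exists (`hLinv`) with the KERNEL bound (3.48) at the rate `δ₀`
    (hLinv : (Qc ∘ₗ (Gp * Gp) ∘ₗ Qcs) * Linv = 1)
    (h348 : ∀ y y' : g.Site, |B9Thm34Inv.ker (B9Thm34Inv.vol g d) Linv y y'| ≤
      B₁ * g.len y ^ (-(4 : ℝ)) * g.len y' ^ (-(d : ℝ)) * Real.exp (-(δ₀ * g.dist y y'))),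
    ∀ (α₁ : ℝ), 0 ≤ α₁ → α₁ ≤ a₁ →
    -- the exponent field `A` in the domain (3.37), read blockwise, and the `A`-dependent (3.59) data `kF`, `sF`
    ∀ (A : κ → S → 𝔸) (kF : g.Site → S → 𝔸 →L[ℝ] 𝔸) (sF : S → 𝔸 →L[ℝ] 𝔸),
      (∀ y x, blk x = y → ‖kF y x‖ ≤ Cq * α₁ * w y) → (∀ x, ‖sF x‖ ≤ Cq * α₁) →
      (∀ ν k x, ‖((g.eta : ℂ)⁻¹) • covDstar T U ν (A k) x‖ ≤ α₁ * (g.len (blk x) ^ 2)⁻¹) →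
      (∀ μ ν x, ‖((g.eta : ℂ)⁻¹) • covD T U μ (A ν) x‖ ≤ α₁ * (g.len (blk x) ^ 2)⁻¹) →
      (∀ μ x, ‖((g.eta : ℂ)⁻¹) • covDstar T U μ (tauB T U μ (A μ)) x‖ ≤ α₁ * (g.len (blk x) ^ 2)⁻¹) →
      (∀ k x, ‖A k x‖ ≤ α₁ * (g.len (blk x))⁻¹) → (∀ ν k x, ‖tauB T U ν (A k) x‖ ≤ α₁ * (g.len (blk x))⁻¹) →
    -- the (3.57)/(3.59) letters `F′₂(A)`, `F′₂*(A)` (block-local, size `c_F α₁`)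
    ∀ {Qc' Fc : (S × ι → ℝ) →ₗ[ℝ] (g.Site → ℝ)} {Qcs' Fcs : (g.Site → ℝ) →ₗ[ℝ] (S × ι → ℝ)},
      Qc' = Qc + Fc → Qcs' = Qcs + Fcs →
      HasMajorantHom (g := toB6 g Rr H) (fun p : S × ι => blk p.1) (fun y : g.Site => y) Fc
        (fun a a' : g.Site => cF * α₁ * (if a = a' then (1 : ℝ) else 0)) →
      HasMajorantHom (g := toB6 g Rr H) (fun y : g.Site => y) (fun p : S × ι => blk p.1) Fcs
        (fun a a' : g.Site => cF * α₁ * (if a = a' then (1 : ℝ) else 0)) →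
    ∃ Tinv : Module.End ℝ (g.Site → ℝ),
      Tinv * (Qc' ∘ₗ ((gPrimeExtEnd Gp (conj b (vPrimeConc T U g.eta A blk kQ kF sQ sF cfun) * Gp)) * (gPrimeExtEnd Gp (conj b (vPrimeConc T U g.eta A blk kQ kF sQ sF cfun) * Gp))) ∘ₗ Qcs') = 1 ∧
      (Qc' ∘ₗ ((gPrimeExtEnd Gp (conj b (vPrimeConc T U g.eta A blk kQ kF sQ sF cfun) * Gp)) * (gPrimeExtEnd Gp (conj b (vPrimeConc T U g.eta A blk kQ kF sQ sF cfun) * Gp))) ∘ₗ Qcs') * Tinv = 1 ∧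
      HasMajorant (g := toB6 g Rr H) (fun q : (κ × S) × ι => blk q.1.2)
        (((conjHom b (gradLin T ((g.eta : ℂ)⁻¹) (prodCfg U g.eta A)) - conjHom b (gradLin T ((g.eta : ℂ)⁻¹) U)) ∘ₗ (Gp ∘ₗ Qcs ∘ₗ Linv ∘ₗ Qc ∘ₗ Gp) ∘ₗ conjHom b (divLin T ((g.eta : ℂ)⁻¹) U)
              + conjHom b (gradLin T ((g.eta : ℂ)⁻¹) U) ∘ₗ (Gp ∘ₗ Qcs ∘ₗ Linv ∘ₗ Qc ∘ₗ Gp) ∘ₗ (conjHom b (divLin T ((g.eta : ℂ)⁻¹) (prodCfg U g.eta A)) - conjHom b (divLin T ((g.eta : ℂ)⁻¹) U))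
              + (conjHom b (gradLin T ((g.eta : ℂ)⁻¹) (prodCfg U g.eta A)) - conjHom b (gradLin T ((g.eta : ℂ)⁻¹) U)) ∘ₗ (Gp ∘ₗ Qcs ∘ₗ Linv ∘ₗ Qc ∘ₗ Gp) ∘ₗ (conjHom b (divLin T ((g.eta : ℂ)⁻¹) (prodCfg U g.eta A)) - conjHom b (divLin T ((g.eta : ℂ)⁻¹) U))
              + conjHom b (gradLin T ((g.eta : ℂ)⁻¹) (prodCfg U g.eta A)) ∘ₗ (B9Eq360Vprime.pPrime Gp (gPrimeExtEnd Gp (conj b (vPrimeConc T U g.eta A blk kQ kF sQ sF cfun) * Gp)) (Qcs ∘ₗ secRes rep) (Qcs' ∘ₗ secRes rep) (secConj rep Linv) (secConj rep Tinv) (secExt rep ∘ₗ Qc) (secExt rep ∘ₗ Qc')) ∘ₗ conjHom b (divLin T ((g.eta : ℂ)⁻¹) (prodCfg U g.eta A))))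
        (fun a a' => K * α₁ * (g.len a ^ 2)⁻¹ * Real.exp (-(1 / 5 * δ₀ * g.dist a a'))) := by
  classical
  have hSb : 0 ≤ ∑ i, ‖b i‖ := Finset.sum_nonneg fun i _ => norm_nonneg _
  -- the three scale-transfer constants of the chain, READ FROM THE GIVEN FUNCTION `Λ(·)` (lattice-free), under the names of FILE 25
  obtain ⟨Λ, hΛ, hΛeq⟩ : ∃ Λ : ℝ, 1 ≤ Λ ∧ Λf (1 / 100) = Λ := ⟨_, hΛf _ (by norm_num), rfl⟩
  obtain ⟨Λρ₁, hΛρ₁1, hΛρ₁eq⟩ : ∃ Λρ₁ : ℝ, 1 ≤ Λρ₁ ∧ Λf (1 / 100 * (33 / 100)) = Λρ₁ := ⟨_, hΛf _ (by norm_num), rfl⟩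
  obtain ⟨c₄, hc₄1, hc₄eq⟩ : ∃ c₄ : ℝ, 1 ≤ c₄ ∧ Λf (1 / 10) = c₄ := ⟨_, hΛf _ (by norm_num), rfl⟩
  have hΛ0 : 0 < Λ := zero_lt_one.trans_le hΛ
  have hΛρ₁ : 0 ≤ Λρ₁ := zero_le_one.trans hΛρ₁1
  have hc₄ : 0 < c₄ := zero_lt_one.trans_le hc₄1
  -- «for α₁ sufficiently small» (pp. 402, 403): the threshold functions and the bound `K` are lattice-free — evaluated BEFORE the lattice
  obtain ⟨ε₁, hε₁, hF1⟩ := exists_threshold_of_continuousAt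
    (f := fun α₁ : ℝ => theta363 (Fintype.card κ) 1 α₁ a₀ Cq M₂ (∑ i, ‖b i‖) (Real.exp (δ₀ * d₀)) BG Λ (B6.c1 d δ₀ (1 / 100)) * B6.c1 d (49 / 50 * δ₀) (1 / 100))
    (by unfold theta363 kappa385 cVConc cBConc; fun_prop) (by simp [theta363])
  obtain ⟨ε₂, hε₂, hF2⟩ := exists_threshold_of_continuousAt
    (f := fun α₁ : ℝ => theta363 (Fintype.card κ) 1 α₁ a₀ Cq M₂ (∑ i, ‖b i‖) (Real.exp (7 / 20 * δ₀ * d₀)) BG Λ (B6.c1 d δ₀ (1 / 100)) * B6.c1 d (33 / 100 * δ₀) (1 / 100))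
    (by unfold theta363 kappa385 cVConc cBConc; fun_prop) (by simp [theta363])
  obtain ⟨ε₃, hε₃, hF3⟩ := exists_threshold_of_continuousAt
    (f := fun α₁ : ℝ => thetaL363 (Fintype.card κ) 1 α₁ a₀ Cq M₂ (∑ i, ‖b i‖) (Real.exp (7 / 20 * δ₀ * d₀)) BG Λ (B6.c1 d δ₀ (1 / 100)) * B6.c1 d (33 / 100 * δ₀) (1 / 100))
    (by unfold thetaL363 kappa385 cVConc cBConc; fun_prop) (by simp [thetaL363])
  obtain ⟨ε₅, hε₅, hF5⟩ := exists_threshold_of_continuousAt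
    (f := fun α₁ : ℝ => α₁ * (2 * (kappa366 κQ cF (kappa385 1 (cVConc (Fintype.card κ) 1 α₁ a₀ Cq M₂ (∑ i, ‖b i‖) (Real.exp (δ₀ * d₀))) 0 0 Λ (B6.c1 d δ₀ (1 / 100))) BG (BG * B6.c1 d (49 / 50 * δ₀) (1 / 100) * (1 - theta363 (Fintype.card κ) 1 α₁ a₀ Cq M₂ (∑ i, ‖b i‖) (Real.exp (δ₀ * d₀)) BG Λ (B6.c1 d δ₀ (1 / 100)) * B6.c1 d (49 / 50 * δ₀) (1 / 100))⁻¹) Λ (B6.c1 d δ₀ (1 / 100)) α₁ * B₁ * c₄ * B6.c1 d δ₀ (1 / 2 + 1 / 10)) * B6.c1 d ((1 / 2 - 1 / 10) * δ₀) (1 / 10)))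
    (by
      unfold theta363 kappa366 kappa385 cVConc cBConc
      fun_prop (disch := simp))
    (by simp)
  -- the constant `κ₁(α₁)` of (3.77) (FILE 16/20's explicit `κ₃₇₇(…)`) is continuous at `α₁ = 0`: a bound `K` below a threshold
  obtain ⟨K, ε₆, hK0, hε₆, hF6⟩ := exists_bound_of_continuousAt
    (f := fun α₁ : ℝ => (kappa377 (4 * (1 + ↑(Fintype.card κ)) * (M₂ * ∑ i, ‖b i‖) * Real.exp (1 / 4 * δ₀ * d₀)) (kappa349 κQ ((1 + ↑(Fintype.card κ)) * BG) B₁ Λ (B6.c1 d δ₀ (1 / 100))) (kappa368 κQ cF (kappa385 1 (cVConc (Fintype.card κ) 1 α₁ a₀ Cq M₂ (∑ i, ‖b i‖) (Real.exp (7 / 20 * δ₀ * d₀))) 0 0 Λ (B6.c1 d δ₀ (1 / 100))) (kappa366 κQ cF (kappa385 1 (cVConc (Fintype.card κ) 1 α₁ a₀ Cq M₂ (∑ i, ‖b i‖) (Real.exp (δ₀ * d₀))) 0 0 Λ (B6.c1 d δ₀ (1 / 100))) BG (BG * B6.c1 d (49 / 50 * δ₀) (1 / 100) * (1 - theta363 (Fintype.card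 κ) 1 α₁ a₀ Cq M₂ (∑ i, ‖b i‖) (Real.exp (δ₀ * d₀)) BG Λ (B6.c1 d δ₀ (1 / 100)) * B6.c1 d (49 / 50 * δ₀) (1 / 100))⁻¹) Λ (B6.c1 d δ₀ (1 / 100)) α₁) BG BG (BG * B6.c1 d (33 / 100 * δ₀) (1 / 100) * (1 - theta363 (Fintype.card κ) 1 α₁ a₀ Cq M₂ (∑ i, ‖b i‖) (Real.exp (7 / 20 * δ₀ * d₀)) BG Λ (B6.c1 d δ₀ (1 / 100)) * B6.c1 d (33 / 100 * δ₀) (1 / 100))⁻¹) B₁ (2 * B₁ * B6.c1 d ((1 / 2 - 1 / 10) * δ₀) (1 / 10)) Λ (B6.c1 d δ₀ (1 / 100)) α₁ + ↑(Fintype.card κ) * kappa368Ds κQ cF (kappa385 BG (cVConc (Fintype.card κ) 1 α₁ a₀ Cq M₂ (∑ i, ‖b i‖) (Real.exp (7 / 20 * δ₀ * d₀))) 0 0 Λ (B6.c1 d δ₀ (1 / 100))) (kappa366 κQ cF (kappa385 1 (cVConc (Fintype.card κ) 1 α₁ a₀ Cq M₂ (∑ i, ‖b i‖) (Real.exp (δ₀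 * d₀))) 0 0 Λ (B6.c1 d δ₀ (1 / 100))) BG (BG * B6.c1 d (49 / 50 * δ₀) (1 / 100) * (1 - theta363 (Fintype.card κ) 1 α₁ a₀ Cq M₂ (∑ i, ‖b i‖) (Real.exp (δ₀ * d₀)) BG Λ (B6.c1 d δ₀ (1 / 100)) * B6.c1 d (49 / 50 * δ₀) (1 / 100))⁻¹) Λ (B6.c1 d δ₀ (1 / 100)) α₁) BG BG BG (B6.c1 d (33 / 100 * δ₀) (1 / 100) * (1 - theta363 (Fintype.card κ) 1 α₁ a₀ Cq M₂ (∑ i, ‖b i‖) (Real.exp (7 / 20 * δ₀ * d₀)) BG Λ (B6.c1 d δ₀ (1 / 100)) * B6.c1 d (33 / 100 * δ₀) (1 / 100))⁻¹) (BG * Λρ₁ ^ 2 * B6.c1 d (33 / 100 * δ₀) (1 / 100) * (1 - thetaL363 (Fintype.card κ) 1 α₁ a₀ Cq M₂ (∑ i, ‖b i‖) (Real.exp (7 / 20 * δ₀ * d₀)) BG Λ (B6.c1 d δ₀ (1 / 100)) * B6.c1 d (33 / 100 * δ₀) (1 / 100))⁻¹) B₁ (2 * B₁ * B6.c1 d ((1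 / 2 - 1 / 10) * δ₀) (1 / 10)) (cBConc (Fintype.card κ) M₂ (∑ i, ‖b i‖) (Real.exp (B9Ineq368Vprime.rateC (1 / 100) (33 / 100 * δ₀) * d₀))) (cCConc (Fintype.card κ) 1 α₁ a₀ Cq M₂ (∑ i, ‖b i‖) (Real.exp (B9Ineq368Vprime.rateC (1 / 100) (33 / 100 * δ₀) * d₀))) Λ (B6.c1 d δ₀ (1 / 100)) α₁) Λ (B6.c1 d δ₀ (1 / 100)) α₁))
    (by
      unfold theta363 thetaL363 kappa368 kappa368Ds kappa377 kappa366 kappa349 kappa385 cCConc cVConc cBConc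
      fun_prop (disch := simp))
  -- the threshold `a₁` and the `α₁`-independent constant `K`
  refine ⟨min (min (min ε₁ ε₂) (min ε₃ ε₅)) (min ε₆ (1 / 2)) / 2,
    half_pos (lt_min (lt_min (lt_min hε₁ hε₂) (lt_min hε₃ hε₅)) (lt_min hε₆ one_half_pos)), K, hK0, ?_⟩
  -- NOW the lattice, the background, the letters and Theorems 3.1/3.2 for `U`; then `α₁`, `A`, the (3.57)/(3.59) letters
  intro S _ _ T U g _ _ _ Rr H blk kQ sQ cfun w hdnn htri hrefl hsym hlen hlenη hη h261 hST hU1 hd₀B hd₀F hd₀0 hw hcard hkQ hsQ hcfun Gp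
    h342_1 h342_2 h342_3 rep hrep Qc Qcs Linv hQc hQcs hLinv h348 α₁ hα₁0 hα₁1 A kF sF hkF hsF h337B h337F h337Bτ hA hAτB Qc' Fc Qcs' Fcs h357 h357s hFc hFcs
  obtain ⟨y₀⟩ := ‹Nonempty g.Site›
  obtain ⟨hT1, hT2, hT1i, hT2i, hT4, -⟩ := hST (1 / 100) (by norm_num)
  obtain ⟨hTρ₁0, -, -, -, -, -⟩ := hST (1 / 100 * (33 / 100)) (by norm_num)
  obtain ⟨-, -, -, -, -, hT4v⟩ := hST (1 / 10) (by norm_num)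
  rw [hΛeq] at hT1 hT2 hT1i hT2i hT4
  rw [hΛρ₁eq] at hTρ₁0
  rw [hc₄eq] at hT4v
  have hTρ₁ : ScaleTransfer g (33 / 100 * δ₀) (1 / 100) Λρ₁ (fun a => g.len a) := scaleTransfer_rescale hTρ₁0
  -- [4] Lemma 2.1 at the (rate, exponent) pairs of the cascade, all read from the one printed rate `δ₀`
  have h261β : Ineq261 d (toB6 g Rr H) δ₀ (1 / 100) := h261 _ (by norm_num) (by norm_num)
  have h261'' : Ineq261 d (toB6 g Rr H) (33 / 100 * δ₀) (1 / 100) :=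
    ineq261_rescale (h261 (1 / 100 * (33 / 100)) (by norm_num) (by norm_num))
  have h261c : Ineq261 d (toB6 g Rr H) (49 / 50 * δ₀) (1 / 100) :=
    ineq261_rescale (h261 (1 / 100 * (49 / 50)) (by norm_num) (by norm_num))
  have h261v : Ineq261 d (toB6 g Rr H) δ₀ (1 / 2 + 1 / 10) := h261 _ (by norm_num) (by norm_num)
  have h261v' : Ineq261 d (toB6 g Rr H) ((1 / 2 - 1 / 10) * δ₀) (1 / 10) :=
    ineq261_rescale (h261 (1 / 10 * (1 / 2 - 1 / 10)) (by norm_num) (by norm_num))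
  -- `c₁ > 0` at these pairs (non-empty 𝔅)
  have hc₂ : 0 < B6.c1 d δ₀ (1 / 100) := c1_pos_of_ineq261 h261β y₀ (hrefl y₀)
  have hc'' : 0 < B6.c1 d (33 / 100 * δ₀) (1 / 100) := c1_pos_of_ineq261 h261'' y₀ (hrefl y₀)
  have hcc' : 0 < B6.c1 d (49 / 50 * δ₀) (1 / 100) := c1_pos_of_ineq261 h261c y₀ (hrefl y₀)
  have hc₁v : 0 < B6.c1 d δ₀ (1 / 2 + 1 / 10) := c1_pos_of_ineq261 h261v y₀ (hrefl y₀)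
  have hc₁v' : 0 < B6.c1 d ((1 / 2 - 1 / 10) * δ₀) (1 / 10) := c1_pos_of_ineq261 h261v' y₀ (hrefl y₀)
  -- the linear side conditions of the cascade
  have hrP : 1 / 5 * δ₀ + 2 * ((1 / 100 + 1 / 100) * δ₀) ≤ 1 / 4 * δ₀ := by linarith only [hδ₀]
  have hrG : 1 / 4 * δ₀ + (2 * (1 / 100) + 1 / 100) * δ₀ ≤ 7 / 20 * δ₀ := by linarith only [hδ₀]
  have hr1 : 33 / 100 * δ₀ + (1 / 100 + 1 / 100) * δ₀ ≤ 7 / 20 * δ₀ := by linarith only [hδ₀]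
  have hr368 : 1 / 4 * δ₀ + 2 * ((2 * (1 / 100) + 1 / 100) * δ₀) ≤ B9Ineq368Vprime.rateC (1 / 100) (33 / 100 * δ₀) := by
    unfold B9Ineq368Vprime.rateC; linarith only [hδ₀]
  have hrc1 : 49 / 50 * δ₀ + (1 / 100 + 1 / 100) * δ₀ ≤ δ₀ := by linarith only [hδ₀]
  have hrc : δ₀ / 2 + (1 / 100 + 1 / 100) * δ₀ ≤ (1 - 1 / 100) * (49 / 50 * δ₀) := by linarith only [hδ₀]
  have hrcG : 7 / 20 * δ₀ + (1 / 100 + 1 / 100) * δ₀ ≤ (1 - 1 / 100) * (49 / 50 * δ₀) := by linarith only [hδ₀]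
  have hGδ1 : 7 / 20 * δ₀ ≤ δ₀ := by linarith only [hδ₀]
  have hrCinv : 7 / 20 * δ₀ ≤ (1 - 1 / 10) * ((1 / 2 - 1 / 10) * δ₀) := by linarith only [hδ₀]
  have hδ5 : 0 ≤ 1 / 5 * δ₀ := by linarith only [hδ₀]
  have hρ₁0 : 0 ≤ 33 / 100 * δ₀ := by linarith only [hδ₀]
  have hρc0 : 0 ≤ 49 / 50 * δ₀ := by linarith only [hδ₀]
  have hα''ρ : 0 ≤ (1 - 1 / 100) * (33 / 100 * δ₀) := by linarith only [hδ₀]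
  have hα''ρ2 : 0 ≤ (1 - 2 * (1 / 100)) * (33 / 100 * δ₀) := by linarith only [hδ₀]
  have hα''ρ3 : 0 ≤ (1 - 3 * (1 / 100)) * (33 / 100 * δ₀) := by linarith only [hδ₀]
  -- «for α₁ sufficiently small» (pp. 402, 403): the four threshold functions of the `C⁻¹(U′U)`/`P′(A)`-chain are CONTINUOUS AT `α₁ = 0` and vanish there
  have hmε₁ : min (min (min ε₁ ε₂) (min ε₃ ε₅)) (min ε₆ (1 / 2)) ≤ ε₁ := (min_le_left _ _).trans ((min_le_left _ _).trans (min_le_left _ _))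
  have hmε₂ : min (min (min ε₁ ε₂) (min ε₃ ε₅)) (min ε₆ (1 / 2)) ≤ ε₂ := (min_le_left _ _).trans ((min_le_left _ _).trans (min_le_right _ _))
  have hmε₃ : min (min (min ε₁ ε₂) (min ε₃ ε₅)) (min ε₆ (1 / 2)) ≤ ε₃ := (min_le_left _ _).trans ((min_le_right _ _).trans (min_le_left _ _))
  have hmε₅ : min (min (min ε₁ ε₂) (min ε₃ ε₅)) (min ε₆ (1 / 2)) ≤ ε₅ := (min_le_left _ _).trans ((min_le_right _ _).trans (min_le_right _ _))
  have hmε₆ : min (min (min ε₁ ε₂) (min ε₃ ε₅)) (min ε₆ (1 / 2)) ≤ ε₆ := (min_le_right _ _).trans (min_le_left _ _)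
  have hmh : min (min (min ε₁ ε₂) (min ε₃ ε₅)) (min ε₆ (1 / 2)) ≤ 1 / 2 := (min_le_right _ _).trans (min_le_right _ _)
  have habs : |α₁| = α₁ := abs_of_nonneg hα₁0
  have h1 : theta363 (Fintype.card κ) 1 α₁ a₀ Cq M₂ (∑ i, ‖b i‖) (Real.exp (δ₀ * d₀)) BG Λ (B6.c1 d δ₀ (1 / 100)) * B6.c1 d (49 / 50 * δ₀) (1 / 100) < 1 / 2 := hF1 α₁ (by rw [habs]; linarith only [hα₁1, hmε₁, hε₁])
  have h2 : theta363 (Fintype.card κ) 1 α₁ a₀ Cq M₂ (∑ i, ‖b i‖) (Real.exp (7 / 20 * δ₀ * d₀)) BG Λ (B6.c1 d δ₀ (1 / 100)) * B6.c1 d (33 / 100 * δ₀) (1 / 100) < 1 / 2 := hF2 α₁ (by rw [habs]; linarith only [hα₁1, hmε₂, hε₂])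
  have h3 : thetaL363 (Fintype.card κ) 1 α₁ a₀ Cq M₂ (∑ i, ‖b i‖) (Real.exp (7 / 20 * δ₀ * d₀)) BG Λ (B6.c1 d δ₀ (1 / 100)) * B6.c1 d (33 / 100 * δ₀) (1 / 100) < 1 / 2 := hF3 α₁ (by rw [habs]; linarith only [hα₁1, hmε₃, hε₃])
  have h5 : α₁ * (2 * (kappa366 κQ cF (kappa385 1 (cVConc (Fintype.card κ) 1 α₁ a₀ Cq M₂ (∑ i, ‖b i‖) (Real.exp (δ₀ * d₀))) 0 0 Λ (B6.c1 d δ₀ (1 / 100))) BG (BG * B6.c1 d (49 / 50 * δ₀) (1 / 100) * (1 - theta363 (Fintype.card κ) 1 α₁ a₀ Cq M₂ (∑ i, ‖b i‖) (Real.exp (δ₀ * d₀)) BG Λ (B6.c1 d δ₀ (1 / 100)) * B6.c1 d (49 / 50 * δ₀) (1 / 100))⁻¹) Λ (B6.c1 d δ₀ (1 / 100)) α₁ * B₁ * c₄ * B6.c1 d δ₀ (1 / 2 + 1 / 10)) * B6.c1 d ((1 / 2 - 1 / 10) * δ₀) (1 / 10)) < 1 / 2 :=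
    hF5 α₁ (by rw [habs]; linarith only [hα₁1, hmε₅, hε₅])
  have h6 := hF6 α₁ (by rw [habs]; linarith only [hα₁1, hmε₆, hε₆])
  have hhalf : (1 / 2 : ℝ) < 1 := by norm_num
  -- `η·α₁(Lʲη)⁻¹ ≦ 1/4` from `α₁ ≦ 1/4` and `η ≦ Lʲη`
  have hsmall : ∀ y : g.Site, g.eta * (α₁ * (g.len y)⁻¹) ≤ 1 / 4 := fun y => by
    have hq : g.eta * (g.len y)⁻¹ ≤ 1 := by
      rw [← div_eq_mul_inv]; exact (div_le_one (hlen y)).mpr (hlenη y)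
    calc g.eta * (α₁ * (g.len y)⁻¹) = α₁ * (g.eta * (g.len y)⁻¹) := by ring
      _ ≤ α₁ * 1 := mul_le_mul_of_nonneg_left hq hα₁0
      _ ≤ 1 / 4 := by linarith only [hα₁1, hmh]
  -- signs of the explicit constants at this `α₁`
  have hcV0E : ∀ E : ℝ, 0 ≤ E →
      0 ≤ kappa385 1 (cVConc (Fintype.card κ) 1 α₁ a₀ Cq M₂ (∑ i, ‖b i‖) E) 0 0 Λ (B6.c1 d δ₀ (1 / 100)) := fun E hE =>
    kappa385_nonneg zero_le_one (cVConc_nonneg hα₁0 ha₀ hCq hM₂ hSb hE) le_rfl le_rfl hΛ0.le hc₂.le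
  have hcV0G : 0 ≤ kappa385 BG (cVConc (Fintype.card κ) 1 α₁ a₀ Cq M₂ (∑ i, ‖b i‖) (Real.exp (7 / 20 * δ₀ * d₀))) 0 0 Λ (B6.c1 d δ₀ (1 / 100)) :=
    kappa385_nonneg hBG.le (cVConc_nonneg hα₁0 ha₀ hCq hM₂ hSb (Real.exp_nonneg _)) le_rfl le_rfl hΛ0.le hc₂.le
  have hNc : 0 < BG * B6.c1 d (49 / 50 * δ₀) (1 / 100) * (1 - theta363 (Fintype.card κ) 1 α₁ a₀ Cq M₂ (∑ i, ‖b i‖) (Real.exp (δ₀ * d₀)) BG Λ (B6.c1 d δ₀ (1 / 100)) * B6.c1 d (49 / 50 * δ₀) (1 / 100))⁻¹ :=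
    mul_pos (mul_pos hBG hcc') (inv_pos.mpr (by linarith only [h1]))
  have hN'' : 0 ≤ BG * B6.c1 d (33 / 100 * δ₀) (1 / 100) * (1 - theta363 (Fintype.card κ) 1 α₁ a₀ Cq M₂ (∑ i, ‖b i‖) (Real.exp (7 / 20 * δ₀ * d₀)) BG Λ (B6.c1 d δ₀ (1 / 100)) * B6.c1 d (33 / 100 * δ₀) (1 / 100))⁻¹ :=
    mul_nonneg (mul_nonneg hBG.le hc''.le) (inv_nonneg.mpr (by linarith only [h2]))
  have hN3 : 0 ≤ B6.c1 d (33 / 100 * δ₀) (1 / 100) * (1 - theta363 (Fintype.card κ) 1 α₁ a₀ Cq M₂ (∑ i, ‖b i‖) (Real.exp (7 / 20 * δ₀ * d₀)) BG Λ (B6.c1 d δ₀ (1 / 100)) * B6.c1 d (33 / 100 * δ₀) (1 / 100))⁻¹ :=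
    mul_nonneg hc''.le (inv_nonneg.mpr (by linarith only [h2]))
  have hN3L : 0 ≤ BG * Λρ₁ ^ 2 * B6.c1 d (33 / 100 * δ₀) (1 / 100) * (1 - thetaL363 (Fintype.card κ) 1 α₁ a₀ Cq M₂ (∑ i, ‖b i‖) (Real.exp (7 / 20 * δ₀ * d₀)) BG Λ (B6.c1 d δ₀ (1 / 100)) * B6.c1 d (33 / 100 * δ₀) (1 / 100))⁻¹ :=
    mul_nonneg (mul_nonneg (mul_nonneg hBG.le (sq_nonneg Λρ₁)) hc''.le) (inv_nonneg.mpr (by linarith only [h3]))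
  have hκC0 : 0 < kappa366 κQ cF (kappa385 1 (cVConc (Fintype.card κ) 1 α₁ a₀ Cq M₂ (∑ i, ‖b i‖) (Real.exp (δ₀ * d₀))) 0 0 Λ (B6.c1 d δ₀ (1 / 100))) BG (BG * B6.c1 d (49 / 50 * δ₀) (1 / 100) * (1 - theta363 (Fintype.card κ) 1 α₁ a₀ Cq M₂ (∑ i, ‖b i‖) (Real.exp (δ₀ * d₀)) BG Λ (B6.c1 d δ₀ (1 / 100)) * B6.c1 d (49 / 50 * δ₀) (1 / 100))⁻¹) Λ (B6.c1 d δ₀ (1 / 100)) α₁ :=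
    kappa366_pos hκQ hcF (hcV0E _ (Real.exp_nonneg _)) hNc hΛ0 hc₂ hα₁0
  have hBc0 : 0 ≤ 2 * B₁ * B6.c1 d ((1 / 2 - 1 / 10) * δ₀) (1 / 10) := mul_nonneg (mul_nonneg zero_le_two hB₁.le) hc₁v'.le
  have hK1nn : 0 ≤ kappa368 κQ cF (kappa385 1 (cVConc (Fintype.card κ) 1 α₁ a₀ Cq M₂ (∑ i, ‖b i‖) (Real.exp (7 / 20 * δ₀ * d₀))) 0 0 Λ (B6.c1 d δ₀ (1 / 100))) (kappa366 κQ cF (kappa385 1 (cVConc (Fintype.card κ) 1 α₁ a₀ Cq M₂ (∑ i, ‖b i‖) (Real.exp (δ₀ * d₀))) 0 0 Λ (B6.c1 d δ₀ (1 / 100))) BG (BG * B6.c1 d (49 / 50 * δ₀) (1 / 100) * (1 - theta363 (Fintype.card κ) 1 α₁ a₀ Cq M₂ (∑ i, ‖b i‖) (Real.exp (δ₀ * d₀)) BG Λ (B6.c1 d δ₀ (1 / 100)) * B6.c1 d (49 / 50 * δ₀) (1 / 100))⁻¹) Λ (B6.c1 d δ₀ (1 / 100)) α₁) BG BG (BG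 * B6.c1 d (33 / 100 * δ₀) (1 / 100) * (1 - theta363 (Fintype.card κ) 1 α₁ a₀ Cq M₂ (∑ i, ‖b i‖) (Real.exp (7 / 20 * δ₀ * d₀)) BG Λ (B6.c1 d δ₀ (1 / 100)) * B6.c1 d (33 / 100 * δ₀) (1 / 100))⁻¹) B₁ (2 * B₁ * B6.c1 d ((1 / 2 - 1 / 10) * δ₀) (1 / 10)) Λ (B6.c1 d δ₀ (1 / 100)) α₁ :=
    kappa368_nonneg hκQ.le hcF.le (hcV0E _ (Real.exp_nonneg _)) hκC0.le hBG.le hBG.le hN'' hB₁.le hBc0 hc₂.le hα₁0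
  have hcB : 0 ≤ cBConc (Fintype.card κ) M₂ (∑ i, ‖b i‖) (Real.exp (B9Ineq368Vprime.rateC (1 / 100) (33 / 100 * δ₀) * d₀)) := by
    unfold cBConc
    exact mul_nonneg (mul_nonneg zero_le_two (Nat.cast_nonneg _))
      (mul_nonneg (mul_nonneg (mul_nonneg zero_le_two hM₂) hSb) (Real.exp_nonneg _))
  have hcC : 0 ≤ cCConc (Fintype.card κ) 1 α₁ a₀ Cq M₂ (∑ i, ‖b i‖)
      (Real.exp (B9Ineq368Vprime.rateC (1 / 100) (33 / 100 * δ₀) * d₀)) := by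
    unfold cCConc
    have i0 : 0 ≤ 2 + Cq * α₁ := by have := mul_nonneg hCq hα₁0; linarith only [this]
    have i1 : 0 ≤ (2 + 8 * (1 : ℝ) ^ 2 * α₁) * (Fintype.card κ : ℝ) := mul_nonneg (by linarith only [hα₁0]) (Nat.cast_nonneg _)
    have i2 : 0 ≤ a₀ * Cq * (2 + Cq * α₁) := mul_nonneg (mul_nonneg ha₀ hCq) i0
    have i3 : 0 ≤ 4 * (Fintype.card κ : ℝ) * (1 : ℝ) ^ 2 := by positivity
    exact mul_nonneg (mul_nonneg (mul_nonneg (add_nonneg (add_nonneg i1 i2) i3) hM₂) hSb) (Real.exp_nonneg _)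
  have hK3nn : 0 ≤ ↑(Fintype.card κ) * kappa368Ds κQ cF (kappa385 BG (cVConc (Fintype.card κ) 1 α₁ a₀ Cq M₂ (∑ i, ‖b i‖) (Real.exp (7 / 20 * δ₀ * d₀))) 0 0 Λ (B6.c1 d δ₀ (1 / 100))) (kappa366 κQ cF (kappa385 1 (cVConc (Fintype.card κ) 1 α₁ a₀ Cq M₂ (∑ i, ‖b i‖) (Real.exp (δ₀ * d₀))) 0 0 Λ (B6.c1 d δ₀ (1 / 100))) BG (BG * B6.c1 d (49 / 50 * δ₀) (1 / 100) * (1 - theta363 (Fintype.card κ) 1 α₁ a₀ Cq M₂ (∑ i, ‖b i‖) (Real.exp (δ₀ * d₀)) BG Λ (B6.c1 d δ₀ (1 / 100)) * B6.c1 d (49 / 50 * δ₀) (1 / 100))⁻¹) Λ (B6.c1 d δ₀ (1 / 100)) α₁) BG BG BG (B6.c1 d (33 / 100 * δ₀) (1 / 100) * (1 - theta363 (Fintype.card κ) 1 α₁ a₀ Cq M₂ (∑ i, ‖b i‖) (Real.exp (7 / 20 * δ₀ * d₀)) BG Λ (B6.c1 d δ₀ (1 / 100)) * B6.c1 d (33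 / 100 * δ₀) (1 / 100))⁻¹) (BG * Λρ₁ ^ 2 * B6.c1 d (33 / 100 * δ₀) (1 / 100) * (1 - thetaL363 (Fintype.card κ) 1 α₁ a₀ Cq M₂ (∑ i, ‖b i‖) (Real.exp (7 / 20 * δ₀ * d₀)) BG Λ (B6.c1 d δ₀ (1 / 100)) * B6.c1 d (33 / 100 * δ₀) (1 / 100))⁻¹) B₁ (2 * B₁ * B6.c1 d ((1 / 2 - 1 / 10) * δ₀) (1 / 10)) (cBConc (Fintype.card κ) M₂ (∑ i, ‖b i‖) (Real.exp (B9Ineq368Vprime.rateC (1 / 100) (33 / 100 * δ₀) * d₀))) (cCConc (Fintype.card κ) 1 α₁ a₀ Cq M₂ (∑ i, ‖b i‖) (Real.exp (B9Ineq368Vprime.rateC (1 / 100) (33 / 100 * δ₀) * d₀))) Λ (B6.c1 d δ₀ (1 / 100)) α₁ :=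
    mul_nonneg (Nat.cast_nonneg _) (kappa368Ds_nonneg hκQ.le hcF.le hcV0G hκC0.le hBG.le hBG.le hBG.le hN3 hN3L hB₁.le hBc0
      hcB hcC hc₂.le hα₁0)
  have hXpos : 0 < 2 * (kappa366 κQ cF (kappa385 1 (cVConc (Fintype.card κ) 1 α₁ a₀ Cq M₂ (∑ i, ‖b i‖) (Real.exp (δ₀ * d₀))) 0 0 Λ (B6.c1 d δ₀ (1 / 100))) BG (BG * B6.c1 d (49 / 50 * δ₀) (1 / 100) * (1 - theta363 (Fintype.card κ) 1 α₁ a₀ Cq M₂ (∑ i, ‖b i‖) (Real.exp (δ₀ * d₀)) BG Λ (B6.c1 d δ₀ (1 / 100)) * B6.c1 d (49 / 50 * δ₀) (1 / 100))⁻¹) Λ (B6.c1 d δ₀ (1 / 100)) α₁ * B₁ * c₄ * B6.c1 d δ₀ (1 / 2 + 1 / 10)) * B6.c1 d ((1 / 2 - 1 / 10) * δ₀) (1 / 10) :=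
    mul_pos (mul_pos two_pos (mul_pos (mul_pos (mul_pos hκC0 hB₁) hc₄) hc₁v)) hc₁v'
  have ha₁' : α₁ ≤ (2 * (kappa366 κQ cF (kappa385 1 (cVConc (Fintype.card κ) 1 α₁ a₀ Cq M₂ (∑ i, ‖b i‖) (Real.exp (δ₀ * d₀))) 0 0 Λ (B6.c1 d δ₀ (1 / 100))) BG (BG * B6.c1 d (49 / 50 * δ₀) (1 / 100) * (1 - theta363 (Fintype.card κ) 1 α₁ a₀ Cq M₂ (∑ i, ‖b i‖) (Real.exp (δ₀ * d₀)) BG Λ (B6.c1 d δ₀ (1 / 100)) * B6.c1 d (49 / 50 * δ₀) (1 / 100))⁻¹) Λ (B6.c1 d δ₀ (1 / 100)) α₁ * B₁ * c₄ * B6.c1 d δ₀ (1 / 2 + 1 / 10)) * B6.c1 d ((1 / 2 - 1 / 10) * δ₀) (1 / 10))⁻¹ := by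
    rw [inv_eq_one_div, le_div_iff₀ hXpos]; linarith only [h5]
  -- §2 with the cascade, the explicit constants and the thresholds
  obtain ⟨Tinv, hTl, hTr, hP₁⟩ := exists_cinv_pOne_concrete (Rr := Rr) (H := H) b T U blk d
    δ₀ (1 / 5 * δ₀) (1 / 4 * δ₀) (7 / 20 * δ₀) δ₀ (49 / 50 * δ₀) (1 / 100) (1 / 10) (1 / 10) c₄ (1 / 100) (1 / 100)
    (33 / 100 * δ₀) (1 / 100) Λ Λρ₁ κQ BG B₁ _ _ cF Cq a₀ _
    (kappa368 κQ cF (kappa385 1 (cVConc (Fintype.card κ) 1 α₁ a₀ Cq M₂ (∑ i, ‖b i‖) (Real.exp (7 / 20 * δ₀ * d₀))) 0 0 Λ (B6.c1 d δ₀ (1 / 100))) (kappa366 κQ cF (kappa385 1 (cVConc (Fintype.card κ) 1 α₁ a₀ Cq M₂ (∑ i, ‖b i‖) (Real.exp (δ₀ * d₀))) 0 0 Λ (B6.c1 d δ₀ (1 / 100))) BG (BG * B6.c1 d (49 / 50 * δ₀) (1 / 100) * (1 - theta363 (Fintype.card κ) 1 α₁ a₀ Cq M₂ (∑ i, ‖b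 i‖) (Real.exp (δ₀ * d₀)) BG Λ (B6.c1 d δ₀ (1 / 100)) * B6.c1 d (49 / 50 * δ₀) (1 / 100))⁻¹) Λ (B6.c1 d δ₀ (1 / 100)) α₁) BG BG (BG * B6.c1 d (33 / 100 * δ₀) (1 / 100) * (1 - theta363 (Fintype.card κ) 1 α₁ a₀ Cq M₂ (∑ i, ‖b i‖) (Real.exp (7 / 20 * δ₀ * d₀)) BG Λ (B6.c1 d δ₀ (1 / 100)) * B6.c1 d (33 / 100 * δ₀) (1 / 100))⁻¹) B₁ (2 * B₁ * B6.c1 d ((1 / 2 - 1 / 10) * δ₀) (1 / 10)) Λ (B6.c1 d δ₀ (1 / 100)) α₁ + ↑(Fintype.card κ) * kappa368Ds κQ cF (kappa385 BG (cVConc (Fintype.card κ) 1 α₁ a₀ Cq M₂ (∑ i, ‖b i‖) (Real.exp (7 / 20 * δ₀ * d₀))) 0 0 Λ (B6.c1 d δ₀ (1 / 100))) (kappa366 κQ cF (kappa385 1 (cVConc (Fintype.card κ) 1 α₁ a₀ Cq M₂ (∑ i, ‖b i‖) (Real.exp (δ₀ * d₀))) 0 0 Λ (B6.c1 d δ₀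 (1 / 100))) BG (BG * B6.c1 d (49 / 50 * δ₀) (1 / 100) * (1 - theta363 (Fintype.card κ) 1 α₁ a₀ Cq M₂ (∑ i, ‖b i‖) (Real.exp (δ₀ * d₀)) BG Λ (B6.c1 d δ₀ (1 / 100)) * B6.c1 d (49 / 50 * δ₀) (1 / 100))⁻¹) Λ (B6.c1 d δ₀ (1 / 100)) α₁) BG BG BG (B6.c1 d (33 / 100 * δ₀) (1 / 100) * (1 - theta363 (Fintype.card κ) 1 α₁ a₀ Cq M₂ (∑ i, ‖b i‖) (Real.exp (7 / 20 * δ₀ * d₀)) BG Λ (B6.c1 d δ₀ (1 / 100)) * B6.c1 d (33 / 100 * δ₀) (1 / 100))⁻¹) (BG * Λρ₁ ^ 2 * B6.c1 d (33 / 100 * δ₀) (1 / 100) * (1 - thetaL363 (Fintype.card κ) 1 α₁ a₀ Cq M₂ (∑ i, ‖b i‖) (Real.exp (7 / 20 * δ₀ * d₀)) BG Λ (B6.c1 d δ₀ (1 / 100)) * B6.c1 d (33 / 100 * δ₀) (1 / 100))⁻¹) B₁ (2 * B₁ * B6.c1 d ((1 / 2 - 1 / 10) * δ₀) (1 / 10))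 (cBConc (Fintype.card κ) M₂ (∑ i, ‖b i‖) (Real.exp (B9Ineq368Vprime.rateC (1 / 100) (33 / 100 * δ₀) * d₀))) (cCConc (Fintype.card κ) 1 α₁ a₀ Cq M₂ (∑ i, ‖b i‖) (Real.exp (B9Ineq368Vprime.rateC (1 / 100) (33 / 100 * δ₀) * d₀))) Λ (B6.c1 d δ₀ (1 / 100)) α₁)
    _ α₁ d₀ M₂ kQ kF sQ sF cfun w
    hκQ hBG hB₁ hcF hCq ha₀ (add_nonneg hK1nn hK3nn) hα₁0 hΛ (by norm_num) (by norm_num) hδ₀ hδ5 hM₂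
    hrP hrG hr1 (by norm_num) (by norm_num) hρ₁0 hα''ρ hα''ρ2 hα''ρ3 hΛρ₁ hr368
    hrc1 hρc0 (by norm_num) (by norm_num) hrc hrcG hGδ1 hGδ1 (by norm_num) (by norm_num) (by norm_num) hc₄ hrCinv hc₁v hc₁v' hc₂ hcc'
    rfl rfl ha₁' rfl rfl hdnn htri hrefl hsym hlen h261β h261'' h261c h261v h261v' hT1 hT2 hT1i hT2i hT4 hTρ₁ hT4v hrepr hη A hsmall hU1
    h337B h337F h337Bτ hA hAτB hd₀B hd₀F hd₀0 h342_1 h342_2 h342_3 rep hrep h357 h357s hQc hQcs hFc hFcs hLinv h348 (h1.trans hhalf)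
    hw hcard hkQ hkF hsQ hsF hcfun (h2.trans hhalf) (h3.trans hhalf) (le_add_of_nonneg_right hK3nn) (le_add_of_nonneg_left hK1nn)
  refine ⟨Tinv, hTl, hTr, hasMajorant_mono (g := toB6 g Rr H) _ hP₁ fun a a' => ?_⟩
  exact mul_le_mul_of_nonneg_right (mul_le_mul_of_nonneg_right (mul_le_mul_of_nonneg_right h6 hα₁0) (inv_nonneg.mpr (sq_nonneg _)))
    (Real.exp_nonneg _)

end POneU

/-! ## §3  FILE 25's `thm34_G_kernel_final` with `a₁`, `B` chosen before the lattice -/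

section FinalU

open Literature.MathematicalPhysics.QuantumFieldTheory.Balaban1983to89.B6RandomWalk (HasMajorant hasMajorant_mono Triangle254 Ineq261)
open Literature.MathematicalPhysics.QuantumFieldTheory.Balaban1983to89.B6RandomWalkHom (HasMajorantHom hasMajorantHom_mono hasMajorantHom_iff)
open Literature.MathematicalPhysics.QuantumFieldTheory.Balaban1983to89.B6RandomWalkKernel (HasKernelBound hasKernelBound_mono)
open Literature.MathematicalPhysics.QuantumFieldTheory.Balaban1983to89.B9Thm34Ext (toB6)
open Literature.MathematicalPhysics.QuantumFieldTheory.Balaban1983to89.B9Ineq347 (ScaleTransfer)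
open Literature.MathematicalPhysics.QuantumFieldTheory.Balaban1983to89.B9Ineq366CPrime (hasMajorant_rate_mono cPrimeHom kappa366 kappa366_nonneg
  kappa366_pos)
open Literature.MathematicalPhysics.QuantumFieldTheory.Balaban1983to89.B9Eq386Neumann (pTwo deltaA)
open Literature.MathematicalPhysics.QuantumFieldTheory.Balaban1983to89.B9Ineq377POne (kappa377 kappa377_nonneg)
open Literature.MathematicalPhysics.QuantumFieldTheory.Balaban1983to89.B9Ineq385VG (kappa383 kappa383_nonneg kappa385 kappa385_nonneg)
open Literature.MathematicalPhysics.QuantumFieldTheory.Balaban1983to89.B9Eq39Adjoint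
open Literature.MathematicalPhysics.QuantumFieldTheory.Balaban1983to89.B9Eq369Small (Through)
open Literature.MathematicalPhysics.QuantumFieldTheory.Balaban1983to89.B9Eq372Locality (stBonds)
open Literature.MathematicalPhysics.QuantumFieldTheory.Balaban1983to89.B9Eq352DivForm (tauF tauB)
open Literature.MathematicalPhysics.QuantumFieldTheory.Balaban1983to89.B9Eq352DivFormLetters
open Literature.MathematicalPhysics.QuantumFieldTheory.Balaban1983to89.B9Eq352GradLetters (diffLetter)
open Literature.MathematicalPhysics.QuantumFieldTheory.Balaban1983to89.B9Eq371GradLetters (bT bU)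
open Literature.MathematicalPhysics.QuantumFieldTheory.Balaban1983to89.B9Eq372RemLetters (lapDDLetter)
open Literature.MathematicalPhysics.QuantumFieldTheory.Balaban1983to89.B9Eq382V3Letters (dPrimeLetter)
open Literature.MathematicalPhysics.QuantumFieldTheory.Balaban1983to89.B9Eq376POneLetters (conjHom gradLin divLin)
open Literature.MathematicalPhysics.QuantumFieldTheory.Balaban1983to89.B9Ineq385V3Concrete (cV385 cV385_nonneg)
open Literature.MathematicalPhysics.QuantumFieldTheory.Balaban1983to89.B9Ineq377POneConcrete (ineq377_concreteE)
open Literature.MathematicalPhysics.QuantumFieldTheory.Balaban1983to89.B9Ineq349Hom (ineq349_hom)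
open Literature.MathematicalPhysics.QuantumFieldTheory.Balaban1983to89.B9Ineq368PPrime (kappa349 kappa368)
open Literature.MathematicalPhysics.QuantumFieldTheory.Balaban1983to89.B9Ineq368PPrimeDs (kappa368Ds kappa368Ds_nonneg kappa368_nonneg kappa349_nonneg)
open Literature.MathematicalPhysics.QuantumFieldTheory.Balaban1983to89.B9Eq360Vprime (gPrimeExtEnd eq365_end_left eq365_end opNorm_lt_one_of_363_261)
open Literature.MathematicalPhysics.QuantumFieldTheory.Balaban1983to89.B9Eq360VprimeLetters (vPrimeConc cBConc cCConc)
open Literature.MathematicalPhysics.QuantumFieldTheory.Balaban1983to89.B9Ineq363Vprime (cVConc cVConc_nonneg theta363 thetaL363 theta363_nonneg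
  thetaL363_nonneg ineq363_op_vPrime)
open Literature.MathematicalPhysics.QuantumFieldTheory.Balaban1983to89.B9Ineq368Vprime (ineq368_op_conc ineq368_op_D_conc ineq368_op_Ds_conc
  ineq368_op_DDs_conc)
open Literature.MathematicalPhysics.QuantumFieldTheory.Balaban1983to89.B9Eq376DerivDict (hasMajorantHom_gradLin_comp hasMajorantHom_gradLin
  hasMajorantHom_comp_divLin hasMajorantHom_divLin hasMajorant_gradLin_comp_comp_divLin)
open Literature.MathematicalPhysics.QuantumFieldTheory.Balaban1983to89.B6RandomWalkSection
open Literature.MathematicalPhysics.QuantumFieldTheory.Balaban1983to89.B9Ineq366Vprime (eq365b_hom hasMajorant_cPrimeHom_vPrime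
  inverse_satisfies_thm32_vPrime)
open Literature.MathematicalPhysics.QuantumFieldTheory.Balaban1983to89.B9Thm34GFinal (ineq261_rescale scaleTransfer_rescale c1_pos_of_ineq261
  exists_threshold_of_continuousAt)
open Literature.MathematicalPhysics.QuantumFieldTheory.Balaban1983to89.B9Thm34GKernel (thm34_G_kernelEntriesAll)
/-! ## §1  (3.77) for the concrete `P₁(A)` as a theorem (site letters; coarse letters through a section) -/
open Literature.MathematicalPhysics.QuantumFieldTheory.Balaban1983to89.B9Thm34GKernelFinal (exists_bound_of_continuousAt)

variable {𝔸 : Type*} [NormedRing 𝔸] [NormedAlgebra ℂ 𝔸] [CompleteSpace 𝔸] {ι : Type} [Fintype ι]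
variable (b : Module.Basis ι ℝ 𝔸) (κ : Type) [Fintype κ] [LinearOrder κ]

set_option maxHeartbeats 800000 in
/-- **THEOREM 3.4, `G`-CLAUSE, FINAL FORM WITH THE CONSTANTS BEFORE THE LATTICE**: `∃ a₁ > 0 ∃ B ≧ 0 ∀ (lattice 𝔅 = g, background U, letters,
Theorems 3.1–3.3 for U incl. Theorem 3.3's kernel members) ∀ α₁ ≦ a₁ ∀ A ∈ (3.37) ∀ (3.57)/(3.59)/(3.80)–(3.81) letters of size O(1)α₁`: THERE EXIST
`C⁻¹(U′U)`, `G(U′U)` (two-sided inverses) with every left/right (3.42)-entry transferred in block-majorant form at `(B, δ₀/10)` AND all four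
entries in the printed kernel form at `(B, δ₀/10)` — FILE 25 `thm34_G_kernel_final` verbatim, re-quantified («There exists a positive constant
a₁ …», p. 400; «the constants … do not depend on the sequence {Ω_j}», p. 399; «of course with different constants», p. 403).  Proof = FILE 25's:
§1 and §2 before the lattice, the threshold for `κ₃₈₅(…, K, …)·α₁·Λ·c₁ < 1` by continuity at `α₁ = 0`, the two `C⁻¹(U′U)` identified by
`left_inv_eq_right_inv`.
[cite: Balaban1985BackgroundPropagators, Thm 3.4 p.400 + p.399 + p.403 + Thm 3.3 p.399 + (3.42) p.397 + (3.76)–(3.77) pp.405–406 + (3.84)–(3.86) p.407; Balaban1984PropagatorsII, Lemma 2.1 p.234] -/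
theorem thm34_G_kernel_uniform [DecidableEq ι] (d : ℕ)
    (δ₀ B₀ κQ BG B₁ cF Cq a₀ C₀ d₀ M₂ κQb cFb abar : ℝ) (Λf : ℝ → ℝ)
    (hB₀ : 0 ≤ B₀) (hκQ : 0 < κQ) (hBG : 0 < BG) (hB₁ : 0 < B₁) (hcF : 0 < cF) (hCq : 0 ≤ Cq) (ha₀ : 0 ≤ a₀) (hC₀ : 0 ≤ C₀)
    (hM₂ : 0 ≤ M₂) (hδ₀ : 0 < δ₀) (hκQb : 0 ≤ κQb) (hcFb : 0 ≤ cFb) (habar : 0 ≤ abar) (hΛf : ∀ α : ℝ, 0 < α → 1 ≤ Λf α)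
    (hrepr : ∀ (v : 𝔸) (i : ι), |b.repr v i| ≤ M₂ * ‖v‖) :
    ∃ a₁ : ℝ, 0 < a₁ ∧ ∃ B : ℝ, 0 ≤ B ∧
    ∀ {S : Type} [Fintype S] [DecidableEq S] (T : κ → Equiv.Perm S) (U : κ → S → 𝔸ˣ)
      {g : B9.Geometry} [Fintype g.Site] [DecidableEq g.Site] [Nonempty g.Site] {Rr : ℝ} {H : Prop} (blk : S → g.Site)
      (kQ : g.Site → S → 𝔸 →L[ℝ] 𝔸) (sQ : S → 𝔸 →L[ℝ] 𝔸) (cfun w : g.Site → ℝ)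
    -- the multiscale geometry 𝔅 (p. 393, [4] (2.1)–(2.4)) and its axioms
    (hdnn : ∀ a a' : g.Site, 0 ≤ g.dist a a') (htri : Triangle254 (toB6 g Rr H)) (hrefl : ∀ y : g.Site, g.dist y y = 0)
    (hsym : ∀ y y' : g.Site, g.dist y y' = g.dist y' y) (hlen : ∀ y : g.Site, 0 < g.len y) (hlenη : ∀ y : g.Site, g.eta ≤ g.len y)
    (hη : 0 < g.eta) (hL : 1 ≤ g.L)
    -- [4] Lemma 2.1 (2.61) at the rate `δ₀`, «for every 0 < α < 1»
    (h261 : ∀ α : ℝ, 0 < α → α < 1 → Ineq261 d (toB6 g Rr H) δ₀ α)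
    -- p. 398: «Using Lemma 2.1 in [4] we may replace the factor (Lʲη)^α by (Lʲη)^β(L^{j′}η)^γ with β + γ = α» — for every exponent, one
    -- constant `Λ(α) ≧ 1` for the six weights `(Lʲη)^{1,2,−1,−2,−4}` (natural and real powers)
      (hST : ∀ α : ℝ, 0 < α → ScaleTransfer g δ₀ α (Λf α) (fun a => g.len a) ∧ ScaleTransfer g δ₀ α (Λf α) (fun a => g.len a ^ 2) ∧
        ScaleTransfer g δ₀ α (Λf α) (fun a => (g.len a)⁻¹) ∧ ScaleTransfer g δ₀ α (Λf α) (fun a => (g.len a ^ 2)⁻¹) ∧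
        ScaleTransfer g δ₀ α (Λf α) (fun a => (g.len a ^ 4)⁻¹) ∧ ScaleTransfer g δ₀ α (Λf α) (fun y => g.len y ^ (-(4 : ℝ))))
    -- real coordinates of `𝔸`, commuting translations, unitary-type background
    (hT : ∀ (μ ν : κ) (x : S), T μ (T ν x) = T ν (T μ x))
    (hU1 : ∀ m z, ‖((U m z : 𝔸ˣ) : 𝔸)‖ ≤ 1 ∧ ‖(((U m z)⁻¹ : 𝔸ˣ) : 𝔸)‖ ≤ 1)
    -- (3.35) on the plaquettes through each bond, at that bond's block scale; stencil geometry at range `d₀`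
    (h35 : ∀ μ x m n y, Through T μ x m n y → ‖(plaqU T U m n y : 𝔸) - 1‖ ≤ C₀ * ((g.L ^ g.scale (blk x))⁻¹) ^ 2)
    (hd₀B : ∀ μ x, g.dist (blk x) (blk ((T μ).symm x)) ≤ d₀) (hd₀F : ∀ μ x, g.dist (blk x) (blk (T μ x)) ≤ d₀)
    (hd₀FB : ∀ μ ν x, g.dist (blk x) (blk ((T ν).symm (T μ x))) ≤ d₀)
    (hd₀st : ∀ μ x (q : κ × S), q ∈ stBonds T μ x → g.dist (blk x) (blk q.2) ≤ d₀)
    (hd₀loc : ∀ μ x (q : κ × S), q ∈ B9Eq375Locality.locBondsA' T μ x → g.dist (blk x) (blk q.2) ≤ d₀)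
    (hd₀0 : ∀ y : g.Site, g.dist y y ≤ d₀)
    -- the `A`-independent data of the concrete `V′(A)` of (3.60): (3.19) kernels/multipliers and the `a`-weights of (3.24)
    (hw : ∀ y, 0 ≤ w y) (hcard : ∀ y, ((B9Eq360Vprime.block blk y).card : ℝ) * w y ≤ 1)
    (hkQ : ∀ y x, blk x = y → ‖kQ y x‖ ≤ w y) (hsQ : ∀ x, ‖sQ x‖ ≤ 1) (hcfun : ∀ y, |cfun y| ≤ a₀ * (g.len y ^ 2)⁻¹)
    -- THEOREM 3.1 for `G′(U)`: (3.42)₁,₂,₃ at the rate `δ₀`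
    {Gp : Module.End ℝ (S × ι → ℝ)}
    (h342_1 : HasMajorant (g := toB6 g Rr H) (fun p : S × ι => blk p.1) Gp
      (fun a a' => BG * g.len a ^ 2 * Real.exp (-(δ₀ * g.dist a a'))))
    (h342_2 : ∀ k : κ ⊕ κ, HasMajorant (g := toB6 g Rr H) (fun p : S × ι => blk p.1)
      (conj b (diffLetter T U ((g.eta : ℂ)⁻¹) k) * Gp) (fun a a' => BG * g.len a * Real.exp (-(δ₀ * g.dist a a'))))
    (h342_3 : ∀ k : κ ⊕ κ, HasMajorant (g := toB6 g Rr H) (fun p : S × ι => blk p.1)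
      (Gp * conj b (diffLetter T U ((g.eta : ℂ)⁻¹) k)) (fun a a' => BG * g.len a * Real.exp (-(δ₀ * g.dist a a'))))
    -- the (3.19) letters `Q′(U)`, `Q′*(U)` in their own typing with block-local two-space majorants, a section of the block map (FILE 17)
    (rep : g.Site → S × ι) (hrep : ∀ y : g.Site, blk (rep y).1 = y)
    {Qc : (S × ι → ℝ) →ₗ[ℝ] (g.Site → ℝ)} {Qcs : (g.Site → ℝ) →ₗ[ℝ] (S × ι → ℝ)} {Linv : Module.End ℝ (g.Site → ℝ)}
    (hQc : HasMajorantHom (g := toB6 g Rr H) (fun p : S × ι => blk p.1) (fun y : g.Site => y) Qc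
      (fun a a' : g.Site => κQ * (if a = a' then (1 : ℝ) else 0)))
    (hQcs : HasMajorantHom (g := toB6 g Rr H) (fun y : g.Site => y) (fun p : S × ι => blk p.1) Qcs
      (fun a a' : g.Site => κQ * (if a = a' then (1 : ℝ) else 0)))
    -- THEOREM 3.2 for `U`: (3.21) `C⁻¹ = (Q′G′²Q′*)⁻¹` exists (`hLinv`) with the KERNEL bound (3.48) at the rate `δ₀`
    (hLinv : (Qc ∘ₗ (Gp * Gp) ∘ₗ Qcs) * Linv = 1)
    (h348 : ∀ y y' : g.Site, |B9Thm34Inv.ker (B9Thm34Inv.vol g d) Linv y y'| ≤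
      B₁ * g.len y ^ (-(4 : ℝ)) * g.len y' ^ (-(d : ℝ)) * Real.exp (-(δ₀ * g.dist y y')))
    -- the (3.15) bond letters `Q(U)`, `Q*(U)` and the weight letter `a` of (3.24)/(3.26), with their majorants
    {G Qs Q a : Module.End ℝ ((κ × S) × ι → ℝ)}
    (hQb : HasMajorant (g := toB6 g Rr H) (fun q : (κ × S) × ι => blk q.1.2) Q (fun a a' => κQb * Real.exp (-(δ₀ * g.dist a a'))))
    (hQsb : HasMajorant (g := toB6 g Rr H) (fun q : (κ × S) × ι => blk q.1.2) Qs (fun a a' => κQb * Real.exp (-(δ₀ * g.dist a a'))))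
    (ha324 : HasMajorant (g := toB6 g Rr H) (fun q : (κ × S) × ι => blk q.1.2) a
      (fun a a' : g.Site => if a = a' then abar * (g.len a ^ 2)⁻¹ else 0))
    -- THEOREM 3.3 for `G(U)`: two-sided inverse of the concrete `Δ_a(U)` and its (3.42)-entries at the rate `δ₀`
    (hΔG : deltaA (conj b (lapDDLetter T ((g.eta : ℂ)⁻¹) U)) (conj b (dPrimeLetter T U g.eta))
      (conjHom b (gradLin T ((g.eta : ℂ)⁻¹) U) ∘ₗ (1 - (Gp ∘ₗ Qcs ∘ₗ Linv ∘ₗ Qc ∘ₗ Gp)) ∘ₗ conjHom b (divLin T ((g.eta : ℂ)⁻¹) U)) Qs a Q * G = 1)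
    (hGΔ : G * deltaA (conj b (lapDDLetter T ((g.eta : ℂ)⁻¹) U)) (conj b (dPrimeLetter T U g.eta))
      (conjHom b (gradLin T ((g.eta : ℂ)⁻¹) U) ∘ₗ (1 - (Gp ∘ₗ Qcs ∘ₗ Linv ∘ₗ Qc ∘ₗ Gp)) ∘ₗ conjHom b (divLin T ((g.eta : ℂ)⁻¹) U)) Qs a Q = 1)
    (hG : HasMajorant (g := toB6 g Rr H) (fun q : (κ × S) × ι => blk q.1.2) G
      (fun a a' => B₀ * g.len a ^ 2 * Real.exp (-(δ₀ * g.dist a a'))))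
    (hDG : ∀ k : κ ⊕ κ, HasMajorant (g := toB6 g Rr H) (fun q : (κ × S) × ι => blk q.1.2)
      (conj b (diffLetter (bT T) (bU U) ((g.eta : ℂ)⁻¹) k) * G) (fun a a' => B₀ * g.len a * Real.exp (-(δ₀ * g.dist a a'))))
    (hGD : ∀ k : κ ⊕ κ, HasMajorant (g := toB6 g Rr H) (fun q : (κ × S) × ι => blk q.1.2)
      (G * conj b (diffLetter (bT T) (bU U) ((g.eta : ℂ)⁻¹) k)) (fun a a' => B₀ * g.len a * Real.exp (-(δ₀ * g.dist a a'))))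
    -- NEW (kernel form): Theorem 3.3's (3.42)₁,₂,₃,₄ for `G(U)` as PRINTED KERNEL BOUNDS (pairing weight `c = η^d`, volume weight `v(y′) = (L^j′ η)^d`)
    {v : g.Site → ℝ} (hv : ∀ y, 0 < v y) {c : ℝ} (hc : 0 < c)
    (hGk : HasKernelBound (g := toB6 g Rr H) (fun q : (κ × S) × ι => blk q.1.2) v c G
      (fun a a' => B₀ * g.len a ^ 2 * Real.exp (-(δ₀ * g.dist a a'))))
    (hDGk : ∀ k : κ ⊕ κ, HasKernelBound (g := toB6 g Rr H) (fun q : (κ × S) × ι => blk q.1.2) v c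
      (conj b (diffLetter (bT T) (bU U) ((g.eta : ℂ)⁻¹) k) * G) (fun a a' => B₀ * g.len a * Real.exp (-(δ₀ * g.dist a a'))))
    (hGDk : ∀ l : κ ⊕ κ, HasKernelBound (g := toB6 g Rr H) (fun q : (κ × S) × ι => blk q.1.2) v c
      (G * conj b (diffLetter (bT T) (bU U) ((g.eta : ℂ)⁻¹) l)) (fun a a' => B₀ * g.len a * Real.exp (-(δ₀ * g.dist a a'))))
    (hDGDk : ∀ k l : κ ⊕ κ, HasKernelBound (g := toB6 g Rr H) (fun q : (κ × S) × ι => blk q.1.2) v c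
      (conj b (diffLetter (bT T) (bU U) ((g.eta : ℂ)⁻¹) k) * G * conj b (diffLetter (bT T) (bU U) ((g.eta : ℂ)⁻¹) l)) (fun a a' => B₀ * Real.exp (-(δ₀ * g.dist a a')))),
    ∀ (α₁ : ℝ), 0 ≤ α₁ → α₁ ≤ a₁ →
    -- the exponent field `A` in the domain (3.37), read blockwise in the shapes of FILES 1–19, and the `A`-dependent (3.59) data `kF`, `sF`
    ∀ (A : κ → S → 𝔸) (kF : g.Site → S → 𝔸 →L[ℝ] 𝔸) (sF : S → 𝔸 →L[ℝ] 𝔸),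
      (∀ y x, blk x = y → ‖kF y x‖ ≤ Cq * α₁ * w y) → (∀ x, ‖sF x‖ ≤ Cq * α₁) →
      (∀ ν k x, ‖((g.eta : ℂ)⁻¹) • covDstar T U ν (A k) x‖ ≤ α₁ * (g.len (blk x) ^ 2)⁻¹) →
      (∀ μ ν x, ‖((g.eta : ℂ)⁻¹) • covD T U μ (A ν) x‖ ≤ α₁ * (g.len (blk x) ^ 2)⁻¹) →
      (∀ μ ν x, ‖((g.eta : ℂ)⁻¹) • covDstar T U ν (A ν) (T μ x)‖ ≤ α₁ * (g.len (blk x) ^ 2)⁻¹) →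
      (∀ μ x, ‖((g.eta : ℂ)⁻¹) • covDstar T U μ (tauB T U μ (A μ)) x‖ ≤ α₁ * (g.len (blk x) ^ 2)⁻¹) →
      (∀ μ ν k x, ‖((g.eta : ℂ)⁻¹) • covD T U μ (A k) ((T ν).symm x)‖ ≤ α₁ * (g.len (blk x) ^ 2)⁻¹) →
      (∀ k x, ‖A k x‖ ≤ α₁ * (g.len (blk x))⁻¹) → (∀ ν k x, ‖tauB T U ν (A k) x‖ ≤ α₁ * (g.len (blk x))⁻¹) →
      (∀ μ k x, ‖tauF T U μ (A k) x‖ ≤ α₁ * (g.len (blk x))⁻¹) →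
      (∀ k μ ν x, ‖A k ((T ν).symm (T μ x))‖ ≤ α₁ * (g.len (blk x))⁻¹) →
      (∀ μ x m z, (m, z) ∈ stBonds T μ x → ‖A m z‖ ≤ α₁ * (g.len (blk x))⁻¹) →
      (∀ μ x m z, (m, z) ∈ B9Eq375Locality.locBondsA T μ x → ‖A m z‖ ≤ α₁ * (g.len (blk x))⁻¹) →
      (∀ μ x m n y, Through T μ x m n y →
        ‖covD T U m (A n) y‖ ≤ g.eta * (α₁ * ((g.len (blk x))⁻¹) ^ 2) ∧ ‖covD T U n (A m) y‖ ≤ g.eta * (α₁ * ((g.len (blk x))⁻¹) ^ 2)) →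
    -- the (3.57)/(3.59) letters `F′₂(A)`, `F′₂*(A)` (block-local, size `c_F α₁`)
    ∀ {Qc' Fc : (S × ι → ℝ) →ₗ[ℝ] (g.Site → ℝ)} {Qcs' Fcs : (g.Site → ℝ) →ₗ[ℝ] (S × ι → ℝ)},
      Qc' = Qc + Fc → Qcs' = Qcs + Fcs →
      HasMajorantHom (g := toB6 g Rr H) (fun p : S × ι => blk p.1) (fun y : g.Site => y) Fc
        (fun a a' : g.Site => cF * α₁ * (if a = a' then (1 : ℝ) else 0)) →
      HasMajorantHom (g := toB6 g Rr H) (fun y : g.Site => y) (fun p : S × ι => blk p.1) Fcs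
        (fun a a' : g.Site => cF * α₁ * (if a = a' then (1 : ℝ) else 0)) →
    -- the (3.80)–(3.81) letters `F₂(A)`, `F₂*(A)` («|F₂(A)|, |F₂*(A)| ≦ O(1)α₁»), `P₂(A)` of (3.82)
    ∀ {P₂ Qs' Q' F₂ F₂s : Module.End ℝ ((κ × S) × ι → ℝ)},
      Q' = Q + F₂ → Qs' = Qs + F₂s → P₂ = pTwo Qs Q F₂ F₂s a →
      HasMajorant (g := toB6 g Rr H) (fun q : (κ × S) × ι => blk q.1.2) F₂ (fun a a' => cFb * α₁ * Real.exp (-(δ₀ * g.dist a a'))) →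
      HasMajorant (g := toB6 g Rr H) (fun q : (κ × S) × ι => blk q.1.2) F₂s (fun a a' => cFb * α₁ * Real.exp (-(δ₀ * g.dist a a'))) →
    ∃ (Tinv : Module.End ℝ (g.Site → ℝ)) (GExt : Module.End ℝ ((κ × S) × ι → ℝ)),
      Tinv * (Qc' ∘ₗ ((gPrimeExtEnd Gp (conj b (vPrimeConc T U g.eta A blk kQ kF sQ sF cfun) * Gp)) * (gPrimeExtEnd Gp (conj b (vPrimeConc T U g.eta A blk kQ kF sQ sF cfun) * Gp))) ∘ₗ Qcs') = 1 ∧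
      (Qc' ∘ₗ ((gPrimeExtEnd Gp (conj b (vPrimeConc T U g.eta A blk kQ kF sQ sF cfun) * Gp)) * (gPrimeExtEnd Gp (conj b (vPrimeConc T U g.eta A blk kQ kF sQ sF cfun) * Gp))) ∘ₗ Qcs') * Tinv = 1 ∧
      deltaA (conj b (lapDDLetter T ((g.eta : ℂ)⁻¹) (prodCfg U g.eta A)))
          (conj b (dPrimeLetter T (prodCfg U g.eta A) g.eta))
          (conjHom b (gradLin T ((g.eta : ℂ)⁻¹) (prodCfg U g.eta A)) ∘ₗ (1 - ((Gp ∘ₗ Qcs ∘ₗ Linv ∘ₗ Qc ∘ₗ Gp) + (B9Eq360Vprime.pPrime Gp (gPrimeExtEnd Gp (conj b (vPrimeConc T U g.eta A blk kQ kF sQ sF cfun) * Gp)) (Qcs ∘ₗ secRes rep) (Qcs' ∘ₗ secRes rep) (secConj rep Linv) (secConj rep Tinv) (secExt rep ∘ₗ Qc) (secExt rep ∘ₗ Qc'))))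
            ∘ₗ conjHom b (divLin T ((g.eta : ℂ)⁻¹) (prodCfg U g.eta A))) Qs' a Q' * GExt = 1 ∧
      GExt *
      deltaA (conj b (lapDDLetter T ((g.eta : ℂ)⁻¹) (prodCfg U g.eta A)))
          (conj b (dPrimeLetter T (prodCfg U g.eta A) g.eta))
          (conjHom b (gradLin T ((g.eta : ℂ)⁻¹) (prodCfg U g.eta A)) ∘ₗ (1 - ((Gp ∘ₗ Qcs ∘ₗ Linv ∘ₗ Qc ∘ₗ Gp) + (B9Eq360Vprime.pPrime Gp (gPrimeExtEnd Gp (conj b (vPrimeConc T U g.eta A blk kQ kF sQ sF cfun) * Gp)) (Qcs ∘ₗ secRes rep) (Qcs' ∘ₗ secRes rep) (secConj rep Linv) (secConj rep Tinv) (secExt rep ∘ₗ Qc) (secExt rep ∘ₗ Qc'))))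
            ∘ₗ conjHom b (divLin T ((g.eta : ℂ)⁻¹) (prodCfg U g.eta A))) Qs' a Q' = 1 ∧
      (∀ (X : Module.End ℝ ((κ × S) × ι → ℝ)) (P : g.Site → ℝ), (∀ y, 0 ≤ P y) →
        HasMajorant (g := toB6 g Rr H) (fun q : (κ × S) × ι => blk q.1.2) (X * G)
          (fun a a' => B₀ * P a * Real.exp (-(δ₀ * g.dist a a'))) →
        HasMajorant (g := toB6 g Rr H) (fun q : (κ × S) × ι => blk q.1.2) (X * GExt)
          (fun a a' => B * P a * Real.exp (-(δ₀ / 6 * g.dist a a')))) ∧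
      (∀ Y : Module.End ℝ ((κ × S) × ι → ℝ),
        HasMajorant (g := toB6 g Rr H) (fun q : (κ × S) × ι => blk q.1.2) (G * Y)
          (fun a a' => B₀ * g.len a * Real.exp (-(δ₀ * g.dist a a'))) →
        HasMajorant (g := toB6 g Rr H) (fun q : (κ × S) × ι => blk q.1.2) (GExt * Y)
          (fun a a' => B * g.len a * Real.exp (-(δ₀ / 6 * g.dist a a')))) ∧
      -- ALL FOUR ENTRIES OF (3.42) FOR `G(U′U)` IN THE PRINTED KERNEL FORM — one constant `B`, rate `δ₀/10`, no (3.77)-hypothesis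
      HasKernelBound (g := toB6 g Rr H) (fun q : (κ × S) × ι => blk q.1.2) v c GExt
        (fun a a' => B * g.len a ^ 2 * Real.exp (-(1 / 10 * δ₀ * g.dist a a'))) ∧
      (∀ k : κ ⊕ κ, HasKernelBound (g := toB6 g Rr H) (fun q : (κ × S) × ι => blk q.1.2) v c
        (conj b (diffLetter (bT T) (bU U) ((g.eta : ℂ)⁻¹) k) * GExt)
        (fun a a' => B * g.len a * Real.exp (-(1 / 10 * δ₀ * g.dist a a')))) ∧
      (∀ l : κ ⊕ κ, HasKernelBound (g := toB6 g Rr H) (fun q : (κ × S) × ι => blk q.1.2) v c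
        (GExt * conj b (diffLetter (bT T) (bU U) ((g.eta : ℂ)⁻¹) l))
        (fun a a' => B * g.len a * Real.exp (-(1 / 10 * δ₀ * g.dist a a')))) ∧
      (∀ k l : κ ⊕ κ, HasKernelBound (g := toB6 g Rr H) (fun q : (κ × S) × ι => blk q.1.2) v c
        (conj b (diffLetter (bT T) (bU U) ((g.eta : ℂ)⁻¹) k) * GExt * conj b (diffLetter (bT T) (bU U) ((g.eta : ℂ)⁻¹) l))
        (fun a a' => B * Real.exp (-(1 / 10 * δ₀ * g.dist a a')))) := by
  classical
  -- FILE 47 §1 (all four kernel entries GIVEN (3.77)) and §2 ((3.77) with the printed quantifiers) — BOTH BEFORE THE LATTICE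
  obtain ⟨a₁, ha₁, B, hB, Λ, hΛ, H1⟩ := thm34_G_kernelEntriesAll_uniform b κ d δ₀ B₀ κQ BG B₁ cF Cq a₀ C₀ d₀ M₂ κQb cFb abar Λf hB₀ hκQ
    hBG hB₁ hcF hCq ha₀ hC₀ hM₂ hδ₀ hκQb hcFb habar hΛf hrepr
  obtain ⟨a₂, ha₂, K, hK, H2⟩ := exists_threshold_pOne_uniform b κ d δ₀ κQ BG B₁ cF Cq a₀ d₀ M₂ Λf hκQ hBG hB₁ hcF hCq ha₀ hM₂ hδ₀ hΛf hrepr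
  -- «of course with different constants», p. 403: the factor `κ₃₈₅(…, K, …)·α₁·Λ·c₁` of FILE 24's kernel constant is continuous at `α₁ = 0` and vanishes there
  obtain ⟨ε, hε, hF⟩ := exists_threshold_of_continuousAt
    (f := fun α₁ : ℝ => (kappa385 B₀ (cV385 (Fintype.card κ) α₁ C₀ (M₂ * (∑ i, ‖b i‖) * Real.exp (1 / 5 * δ₀ * d₀))) K (kappa383 κQb cFb abar Λ (B6.c1 d δ₀ (1 / 100)) α₁) Λ (B6.c1 d δ₀ (1 / 100)) * α₁) * Λ * B6.c1 d δ₀ (1 / 100))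
    (by
      unfold kappa385 kappa383 cV385 B9Eq382V3Letters.cV0 B9Eq373V3.kΔ B9Eq373V3.kP
      fun_prop)
    (by simp)
  refine ⟨min (min a₁ a₂) (ε / 2), lt_min (lt_min ha₁ ha₂) (half_pos hε), B₀ + B, add_nonneg hB₀ hB, ?_⟩
  -- NOW the lattice, the background, the letters, Theorems 3.1–3.3 for `U` and the kernel inputs; then `α₁`, `A` and the `A`-letters
  intro S _ _ T U g _ _ _ Rr H blk kQ sQ cfun w hdnn htri hrefl hsym hlen hlenη hη hL h261 hST hT hU1 h35 hd₀B hd₀F hd₀FB hd₀st hd₀loc hd₀0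
    hw hcard hkQ hsQ hcfun Gp h342_1 h342_2 h342_3 rep hrep Qc Qcs Linv hQc hQcs hLinv h348 G Qs Q a hQb hQsb ha324 hΔG hGΔ hG hDG hGD v hv c hc
    hGk hDGk hGDk hDGDk α₁ hα₁0 hα₁1 A kF sF hkF hsF h337B h337F h337B' h337Bτ h337FB hA hAτB hAτF hAFB hAst hAloc hdAst Qc' Fc Qcs' Fcs h357 h357s hFc hFcs P₂ Qs' Q' F₂ F₂s h380 h380s hP₂def hF₂ hF₂s
  replace H1 := H1 T U blk kQ sQ cfun w hdnn htri hrefl hsym hlen hlenη hη hL h261 hST hT hU1 h35 hd₀B hd₀F hd₀FB hd₀st hd₀loc hd₀0 hw hcard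
    hkQ hsQ hcfun h342_1 h342_2 h342_3 rep hrep hQc hQcs hLinv h348 hQb hQsb ha324 hΔG hGΔ hG hDG hGD hv hc hGk hDGk hGDk hDGDk
  replace H2 := H2 T U blk kQ sQ cfun w hdnn htri hrefl hsym hlen hlenη hη h261 hST hU1 hd₀B hd₀F hd₀0 hw hcard hkQ hsQ hcfun h342_1 h342_2
    h342_3 rep hrep hQc hQcs hLinv h348
  have hα₁a : α₁ ≤ a₁ := hα₁1.trans ((min_le_left _ _).trans (min_le_left _ _))
  have hα₁b : α₁ ≤ a₂ := hα₁1.trans ((min_le_left _ _).trans (min_le_right _ _))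
  have hα₁ε : |α₁| < ε := by
    rw [abs_of_nonneg hα₁0]; linarith only [hα₁1, min_le_right (min a₁ a₂) (ε / 2), hε]
  obtain ⟨Tinv, GExt, e1, e2, e3, e4, hLeft, hRight, hKer⟩ := H1 α₁ hα₁0 hα₁a A kF sF hkF hsF h337B h337F h337B' h337Bτ h337FB hA hAτB
    hAτF hAFB hAst hAloc hdAst h357 h357s hFc hFcs h380 h380s hP₂def hF₂ hF₂s
  obtain ⟨Tinv₂, f1, -, hP₁⟩ := H2 α₁ hα₁0 hα₁b A kF sF hkF hsF h337B h337F h337Bτ hA hAτB h357 h357s hFc hFcs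
  -- the two `C⁻¹(U′U)` agree (uniqueness of the two-sided inverse), so §3's (3.77) is FILE 24's hypothesis at `κ₁ := K`
  have hTT : Tinv₂ = Tinv := left_inv_eq_right_inv f1 e2
  rw [hTT] at hP₁
  obtain ⟨k1, k2, k3, k4⟩ := hKer K hK hP₁
  -- the kernel constant `B₀ + B·θ(α₁)·Λ·c₁ ≦ B₀ + B`
  have hθ := hF α₁ hα₁ε
  have hconst : B₀ + B * (kappa385 B₀ (cV385 (Fintype.card κ) α₁ C₀ (M₂ * (∑ i, ‖b i‖) * Real.exp (1 / 5 * δ₀ * d₀))) K (kappa383 κQb cFb abar Λ (B6.c1 d δ₀ (1 / 100)) α₁) Λ (B6.c1 d δ₀ (1 / 100)) * α₁) * Λ * B6.c1 d δ₀ (1 / 100) ≤ B₀ + B := by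
    have h' : B * ((kappa385 B₀ (cV385 (Fintype.card κ) α₁ C₀ (M₂ * (∑ i, ‖b i‖) * Real.exp (1 / 5 * δ₀ * d₀))) K (kappa383 κQb cFb abar Λ (B6.c1 d δ₀ (1 / 100)) α₁) Λ (B6.c1 d δ₀ (1 / 100)) * α₁) * Λ * B6.c1 d δ₀ (1 / 100)) ≤ B * 1 :=
      mul_le_mul_of_nonneg_left (by linarith only [hθ]) hB
    have e : B * (kappa385 B₀ (cV385 (Fintype.card κ) α₁ C₀ (M₂ * (∑ i, ‖b i‖) * Real.exp (1 / 5 * δ₀ * d₀))) K (kappa383 κQb cFb abar Λ (B6.c1 d δ₀ (1 / 100)) α₁) Λ (B6.c1 d δ₀ (1 / 100)) * α₁) * Λ * B6.c1 d δ₀ (1 / 100) = B * ((kappa385 B₀ (cV385 (Fintype.card κ) α₁ C₀ (M₂ * (∑ i, ‖b i‖) * Real.exp (1 / 5 * δ₀ * d₀))) K (kappa383 κQb cFb abar Λ (B6.c1 d δ₀ (1 / 100)) α₁) Λ (B6.c1 d δ₀ (1 / 100)) * α₁) * Λ * B6.c1 d δ₀ (1 / 100)) := by ring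
    rw [e]; linarith only [h']
  have hw1 : ∀ a : g.Site, 0 ≤ g.len a := fun a => (hlen a).le
  have hw2 : ∀ a : g.Site, 0 ≤ g.len a ^ 2 := fun a => sq_nonneg _
  have hBB : B ≤ B₀ + B := le_add_of_nonneg_left hB₀
  refine ⟨Tinv, GExt, e1, e2, e3, e4, fun X P hP0 hXG => ?_, fun Y hGY => ?_, ?_, fun k => ?_, fun l => ?_, fun k l => ?_⟩
  · exact hasMajorant_mono (g := toB6 g Rr H) _ (hLeft X P hP0 hXG) fun a a' =>
      mul_le_mul_of_nonneg_right (mul_le_mul_of_nonneg_right hBB (hP0 a)) (Real.exp_nonneg _)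
  · exact hasMajorant_mono (g := toB6 g Rr H) _ (hRight Y hGY) fun a a' =>
      mul_le_mul_of_nonneg_right (mul_le_mul_of_nonneg_right hBB (hw1 a)) (Real.exp_nonneg _)
  · exact hasKernelBound_mono (g := toB6 g Rr H) _ hv k1 fun a a' =>
      mul_le_mul_of_nonneg_right (mul_le_mul_of_nonneg_right hconst (hw2 a)) (Real.exp_nonneg _)
  · exact hasKernelBound_mono (g := toB6 g Rr H) _ hv (k2 k) fun a a' =>
      mul_le_mul_of_nonneg_right (mul_le_mul_of_nonneg_right hconst (hw1 a)) (Real.exp_nonneg _)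
  · exact hasKernelBound_mono (g := toB6 g Rr H) _ hv (k3 l) fun a a' =>
      mul_le_mul_of_nonneg_right (mul_le_mul_of_nonneg_right hconst (hw1 a)) (Real.exp_nonneg _)
  · exact hasKernelBound_mono (g := toB6 g Rr H) _ hv (k4 k l) fun a a' =>
      mul_le_mul_of_nonneg_right hconst (Real.exp_nonneg _)

end FinalU

end Literature.MathematicalPhysics.QuantumFieldTheory.Balaban1983to89.B9Thm34GKernelUniform

end
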